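import Literature.Probability.RandomPlanarGeometry.YangBaxterSAWHexBridges
import Literature.Probability.RandomPlanarGeometry.YangBaxterSAWUnwoundPlaquette
import Literature.Barriers.CriticalPhenomena.PlaquetteWalkMirrorDuality
import Literature.Probability.RandomPlanarGeometry.HexSAWVertexRelationHoleRoot
import Literature.Barriers.CriticalPhenomena.PlaquetteWalkContourSum
import Literature.Barriers.CriticalPhenomena.PlaquetteWalkHoleRootFarCellLaw
import HarnessLib

/-!
# The `θ = π/3` dictionary of Glazman–Manolescu, parafermionic version: the rhombic winding of a
Yang–Baxter walk is the honeycomb turning number of its triangle walk (arbitrary domain)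

Topic `Literature/Probability/RandomPlanarGeometry`; companion of `YangBaxterSAWHexBridges.lean` (the WEIGHT
half of the dictionary, for bridges of the strip: `Face.hv`, `YBWalk.arcHV/hvUpTo/hvInner`, `weight_hex_eq`,
`isMidWalk_hvBridge`, `pairEdges_hvBridge`) and of the honeycomb files `HexSAWWinding.lean` (`HV.turn`,
`HV.pturn`), `HexSAWObservable.lean` (`HV.pwt = x_c^ℓ λ^{pturn}`, `HV.lam = e^{−5πi/24}`), `HexSAWStrip.lean`
(`HV.IsMidWalk`).

What the sources print. A. Glazman, I. Manolescu, *Self-avoiding walk on ℤ² with Yang–Baxter weights: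
universality of critical fugacity and 2-point function*, arXiv:1708.00395v3, §1 (p. 3, with Fig. 2): «if Θ is
the constant sequence equal to π/3, then each rhombus of H(Θ) may be partitioned into triangles, and H(Θ)
becomes a triangular lattice. The self-avoiding walk model described above becomes that on the hexagonal
lattice dual to the triangular one, with weight 1/(√(2 − √2))^{|γ|}» [sic: a sign slip in the source — the weight
is `x_c^{|γ|}`, `x_c = 1/√(2+√2)`, as §4 prints: «SAW on H(π/3) is identical to that on the hexagonal lattice with the
weight of a path γ given by (√(2+√2))^{−|γ|}»; the tree's `YangBaxterSAWHexBridges` marks the same slip]; §2.1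
(definition of the parafermionic
observable, eq. (2.1)): the winding `wind(γ)` of a walk is the total rotation of its arcs, an arc from `z_W`
to `z_N` «has winding θ and the arc from z_W to z_S has winding θ − π» (the tree's `arcTurn`,
`YBWalk.winding`, `YBWalk.paraWeight = w(γ) e^{−i(5/8)wind(γ)}`). H. Duminil-Copin, S. Smirnov, Ann. of
Math. 175 (2012), Definition 1: `F(z) = Σ_{γ ⊂ Ω : a → z} e^{−iσW_γ(a,z)} x^{ℓ(γ)}`, `σ = 5/8`, `W_γ` «the
total rotation of the direction in radians when γ is traversed from a to b» (sic, for the walk from a to z; the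
tree's `HV.pwt`, `W = (π/3)·pturn`).

What is formalised here (namespace `…SAW.YangBaxter`): the dictionary at the level of the PARAFERMIONIC
weight, i.e. including the WINDING, for walks on an ARBITRARY domain `D` with arbitrary endpoints.

* §1 `Face.hvAcross f s` — the triangle across the side `s` of `f` (in the neighbouring rhombus);
  `hvAcross_eq_of_side_eq` (it is the triangle of the neighbour resting on the common side), `hv_adj_hvAcross`
  (crossing a side is a honeycomb edge), `hvAcross_ne_hv`, `hvAcross_inj`, translation lemmas.
* §2 `Face.arcPturn f s t` — the honeycomb turns of the arc `s → t` framed by the triangles across its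
  ends; ★ `arcTurn_pi_div_three_eq : arcTurn (π/3) s t = (π/3) · arcPturn f s t` for all twelve pairs
  `s ≠ t` (THE LOCAL DICTIONARY; the table `±1, ±2, 0` is checked by `decide` against the tree's
  orientation of `HV.turn`, translation invariance reduces to the rhombus `(0, 0)`).
* §3 `YBWalk.hvWalk γ` — the honeycomb walk of a Yang–Baxter walk: the triangle across the first mid-edge,
  the triangles crossed (`hvInner`, tree), the triangle across the last mid-edge; `framedArc`,
  `pturn_framedArc`, `acrossOut_eq_hv_succ` / `acrossIn_succ_eq_hv` (consecutive framed arcs overlap in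
  two vertices), `pturn_framedUpTo` (the turning number is the sum of the local values) and ★★
  `winding_pi_div_three_eq_pturn : γ.winding (fun _ => π/3) = (π/3) · HV.pturn γ.hvWalk` — THE WINDING
  DICTIONARY, for every walk on every domain.
* §4 ★ `exp_winding_pi_div_three` (`e^{−i(5/8)wind(γ)} = λ^{pturn}`), `mwLen_hvWalk`, ★★
  `paraWeight_pi_div_three : w(γ) ≠ 0 → γ.paraWeight (fun _ => π/3) = HV.pwt γ.hvWalk` — THE
  PARAFERMIONIC WEIGHT OF A YANG–BAXTER WALK AT `π/3` IS DUMINIL-COPIN–SMIRNOV'S WEIGHT OF ITS HONEYCOMB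
  WALK (the tree's `weight_hex_eq` supplies `w(γ) = x_c^ℓ`; the walks of weight `0` are those through a
  rhombus with two `u₂`-arcs, `w₂(π/3) = 0`); `paraWeight_pi_div_three_or` (dichotomy form).
* §5 `edgeOf_hv_hvAcross`, `edgeOf_hvAcross_hv`, ★ `pairEdges_hvWalk : pairEdges γ.hvWalk = γ.mids`
  (nontrivial walks: THE ENCODING IS INJECTIVE — the mid-edges are read off the honeycomb walk),
  `eq_of_hvWalk_eq`.
* §6 rooted walks (`a = origin`, the western neighbour `(−1, 0)` of the rhombus `(0, 0)` outside `D`):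
  `fc_zero_of_origin`, `acrossIn_zero_of_origin` (`= w`), `hv_zero_of_origin` (`= O`),
  `hvWalk_of_origin_trivial` (`= [w, O]`), `hvWalk_of_origin`, `prevTri` / `cons_hvInner_eq_append_pair` /
  `acrossOut_ne_prevTri` / `prevOf_hvInner_of_origin` (no retracing of the last step), ★★
  `isMidWalk_hvWalk_of_origin : HV.IsMidWalk V γ.hvWalk` for every honeycomb vertex set `V` containing
  the triangles of `D` and every walk of nonzero weight (DCS's self-avoiding mid-edge walk from the root
  `a = {w, O}`; self-avoidance is the tree's `nodup_hvUpTo`), `pairEdges_hvWalk_of_origin` (injective on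
  all walks), `finalDart_hvWalk_of_origin`, `edgeOf_finalDart_hvWalk_of_origin` (the final half-edge
  crosses the final mid-edge `z`).

* §7 (edition 3) appending one arc (the tree's `YBWalk.snoc` / any `δ` with `δ.arcs = γ.arcs ++ [(z, e)]`):
  `fc_sIn_sOut_of_arcs_snoc_lt/_length`, `hvInner_of_arcs_snoc`, ★ `hvWalk_of_arcs_snoc` and
  `hvWalk_of_arcs_snoc_origin` (the honeycomb walk grows by the new arc's triangles).
* §8 honeycomb-side lemmas: `triSet DF` (all triangles of a finite set of rhombi), `mem_triSet_iff`,
  `wOut_not_mem_triSet`, ★ `adj_hv_cases` (the three neighbours of a triangle: the diagonal partner and the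
  two triangles across its sides), ★ `edgeOf_eq_some_side` (the two triangles bordering a side),
  `eq_hvAcross_of_edgeOf_hv`, `YBWalk.mem_pairEdges_iff_edgeOf`, `HVAux.isMidWalk_dropLast_cons_append` /
  `isMidWalk_prefix` (prefixes of mid-edge walks are mid-edge walks), `finalDart_cons_append'`,
  `not_mem_of_isMidWalk`, `nodup_cons_of_isMidWalk`, `Face.eq_of_side_pair_eq`,
  `exists_hv_mem_hvInner_of_mem_facesVisited`, `inner_hvWalk_of_origin`, `edgeOf_finalDart_hvWalk_of_origin'`.
* §9 ★★★ `YBWalk.exists_hvWalk_eq` — **SURJECTIVITY**: every self-avoiding mid-edge walk of the triangle domain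
  from the root `{w, O}` whose final half-edge crosses a rhombus side is `hvWalk γ` for a Yang–Baxter walk `γ`
  from the origin (strong induction on the length, peeling the last arc — one triangle or two — with the
  tree's `snoc`; the no-crossing and freshness conditions come from the self-avoidance of the triangle list).
* §10 ★★ `YBWalk.weight_pi_div_three_ne_zero_iff_nodup` — **THE WEIGHT CRITERION**: `w_{π/3}(γ) ≠ 0` iff the
  triangle list is self-avoiding (→ is the tree's `nodup_hvUpTo`; ← by induction on the arcs through the
  tree's `extWeight_of_snoc` / `kindsIn_of_snoc`: a rhombus already carrying an arc can only receive a second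
  `θ`-corner arc at its other triangle, weight `w₁ = x_c² ≠ 0`; shapes `shape_of_localWeight_pi_div_three_ne_zero`,
  `hv_mem_hvInner_of_kindsIn`, `exists_two_arcs_of_two_le_length_kindsIn`).
* §11 `hexObservableAt V z` (DCS's `F` at a rhombus side: the sum of `x_c^ℓ λ^{pturn}` over the mid-edge walks
  of `V` from `{w, O}` whose final half-edge crosses `z`) and ★★★
  `parafermionOn_pi_div_three_eq_hexObservableAt` — **THE OBSERVABLE IDENTITY**: for every finite set of rhombi
  `D` not containing `(−1, 0)` and every mid-edge `z`,
  `parafermionOn D origin (fun _ => π/3) z = hexObservableAt (triSet DF) z` (GM19's observable of the rhombic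
  domain at `Θ ≡ π/3` IS DCS's observable of its triangle domain; `Finset.sum_bij` along `hvWalk`).
* §12 `edir_hv_hvAcross` (the directions across the four sides are `(2ω − 1)·(1, −1, e^{iπ/3}, −e^{iπ/3})`,
  `2ω − 1 = i√3`), `dartCoeff_add_dartCoeff_eq` / `cv_add_cv_eq` / ★★ `sum_cv_add_cv_eq` (the left-hand sides
  of DCS's relations at the two triangles of a rhombus add up to `Σ_s (direction across s)·F(f.side s)` — the
  short diagonal cancels) and ★★★ `vertexFunctional_printed_pi_div_three_eq_sum_cv` — **THE VERTEX FUNCTIONAL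
  AT `θ = π/3` IS THE SUM OF THE TWO TRIANGLE RELATIONS**:
  `(2ω − 1)·VF_{Dl}(printedWeights (π/3); origin; f) = Σ_{P ∈ midWalks (triSet Dl)} (cv (f.hv W) P + cv (f.hv E) P)`
  for every finite `Dl ∌ (−1, 0)` and every rhombus `f` (`two_mul_omg_sub_one_ne_zero`). With the tree's
  `HexParafermionLoop.vertex_relation_of_wnd` this re-proves GM19's Lemma 2.1 at `θ = π/3` for every root face
  outside all cycles, and with the lane's `HexSAWVertexRelationHoleRoot.sum_cv_eq_sum_encircling` it gives the
  hole-root defect of the Yang–Baxter relation at `π/3` as `(2ω − 1)⁻¹` times the signed weight of the honeycomb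
  loop walks through the two triangles of `f` that ENCIRCLE the root face (the lane's numerical law of
  `FINDING-HEX-HOLE-ROOT-DEFECT.md`, now a composition of two tree theorems).

* §13 (edition 4) translations: `Face.shiftBy`, `MidEdge.shiftBy`, `YBWalk.shiftBy` / `shiftByEquiv` (a bijection of
  walks onto the translated domain), `weight_shiftBy` / `winding_shiftBy` / `paraWeight_shiftBy` (constant angle),
  ★ `YBWalk.parafermionOn_shiftBy` (translation invariance of the observable, GM19 §4.2's «G_Θ(a,b) = G_Θ(0,b−a)»
  for constant Θ and arbitrary finite domains).
* §14 the dictionary at every `W`-rooted rhombus: `vertexFunctional_printed_shiftBy` (translation invariance of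
  the vertex functional, any θ), ★★★ `vertexFunctional_printed_pi_div_three_eq_sum_cv_of_W_root` and ★★
  `parafermionOn_pi_div_three_eq_hexObservableAt_of_W_root` (root on the `W` side of any rhombus `w` whose
  western neighbour is outside the list: translate by `−w`), ★★ `vertexFunctional_printed_pi_div_three_eq_sum_crCoef`
  (GM19's (CR) contour form at π/3 through DCS's observable: `VF = Σ_s crCoef (π/3) s · F_hex(f.side s)`, the
  factor `2ω − 1` cancelled — the custodian's control d4 made a theorem).

Why (lane «pcv-sawmu», Tier B): the Yang–Baxter vertex functional of the lane's plaquette files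
(`PlaquetteWalk*`) at the endpoint `θ = π/3` and Duminil-Copin–Smirnov's vertex relation on the honeycomb
lattice (`HexParafermionLoop`, the lane's `HexSAWVertexRelationHoleRoot`) are the same object; editions 1–2 gave
the walk-by-walk half (weights AND phases agree, injectivity), edition 3 the bijection and the two identities.

Design notes. (1) Everything is stated for a general `D : Set Face` and general endpoints; only §6 fixes the
root at the origin, which is the honeycomb files' convention (`HV.IsMidWalk` starts `w, O`); other roots are
reached by the lattice symmetries of the two models (translations: `HV.tr`, `HV.turn_tr`; the lane's
`PlaquetteWalkMirrorDuality` for the orientation of the root). (2) The trivial walk has no rhombus; its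
honeycomb walk is defined through the junk values of `fc 0 / sIn 0`, which at the origin evaluate to the
rhombus `(0, 0)` entered from `W`, so that `hvWalk = [w, O]` (DCS's trivial walk) — `fc_zero_of_origin`
covers both cases. (3) No analysis: the only real-number fact is the table `arcTurn (π/3) s t ∈ (π/3)·ℤ`.

References: [GlazmanManolescu2019] §1 (p. 3, Fig. 2), §2.1 (eq. (2.1)), §4.2; [DuminilCopinSmirnov2012] §1–§2,
Definition 1; the identification of the θ = π/3 model with the hexagonal-lattice walk goes back to
[Glazman2015WeightedSAW] (§2, case θ = π/3), as GM19 §1 says («As explained in [Gl]», [Gl] = that paper). Status: CONSOLIDATION / dictionary (the printed sentence «becomes that on the hexagonal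
lattice» made parafermionic and bijective: weights, windings, self-avoidance, the observable and the vertex
functional, on arbitrary finite domains); new only in bookkeeping — the identity of the two observables at
`θ = π/3` is what GM19 §1 asserts in words; the vertex-functional form is the lane's use of it. Written for the
venture lane «pcv-sawmu» (Tier B SEARCH 1, b-engine-1 gen 18). Editions: ed.1/ed.2 = §1–§6 (ed.2: docstring
token HD-1); ed.3 = ed.2 verbatim ⊕ §7–§12 (appended) and the imports `YangBaxterSAWUnwoundPlaquette` (for
`parafermionOn`, `vertexFunctional`, the Lemma-2.1 defect form) added next to `YangBaxterSAWHexBridges`; ed.4 =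
ed.3 ⊕ §13–§14 (appended; two docstring tokens HD-2/HD-3 of the cross-family referee folded in the header and
in §6); ed.6 = ed.4 minus the two §8 duplicates of the tree's `arcFace_of_isWE` / `arcFace_of_isSN`
(`YangBaxterSAWGrouping`, now used directly; token HD-4) and one locator («§3, proof of Lemma 2», HD-5); ed.8 = ed.6 with six
docstring cite tags (token HX-3) and the [Gla15] reference line (HX-2); ed.11 = ed.8 ⊕ §16 (appended) and
the import `PlaquetteWalkMirrorDuality` (the `E`-, `S`- and `N`-rooted forms of §14 by the dihedral covariance of the
vertex functional; §15, the composition with `HexSAWVertexRelationHoleRoot`, follows in a later edition once that module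
is built); ed.12 = ed.11 ⊕ §15 (appended) and the import `HexSAWVertexRelationHoleRoot`; ed.13 = ed.12 ⊕ §17
(appended) and the import `PlaquetteWalkContourSum` (boundary flux = total encircling weight); ed.14 = ed.13 ⊕ §18 (appended) and
the import `PlaquetteWalkHoleRootFarCellLaw` (cross-check with the honeycomb far-cell law).
-/

noncomputable section

open Real

namespace Literature.Probability.RandomPlanarGeometry.SAW.YangBaxter

open MidEdge

/-! ## §1. The triangle across a side -/

/-- **The triangle across a side**: the triangle of the neighbouring rhombus that rests on the side `s`
of `f` from outside (`W`: the `E`-triangle of the western neighbour, `E`: the `W`-triangle of the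
eastern one, `N`: the `S`-triangle of the northern one, `S`: the `N`-triangle of the southern one).
[cite: GlazmanManolescu2019, §1 (Fig. 2)] -/
def Face.hvAcross (f : Face) : Side → HV
  | .W => (-f.2, f.1 - 1, true)
  | .E => (-f.2, f.1 + 1, false)
  | .N => (-(f.2 + 1), f.1, true)
  | .S => (-(f.2 - 1), f.1, false)

/-- The triangle across a common side of two different rhombi is the triangle of the other rhombus
resting on that side. [cite: GlazmanManolescu2019, §1 (Fig. 2)] -/
theorem Face.hvAcross_eq_of_side_eq {f g : Face} {s t : Side} (h : f.side s = g.side t) (hfg : f ≠ g) :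
    f.hvAcross s = g.hv t := by
  rcases side_eq_side_cases h hfg with ⟨rfl, rfl, rfl⟩ | ⟨rfl, rfl, rfl⟩ | ⟨rfl, rfl, rfl⟩ | ⟨rfl, rfl, rfl⟩ <;>
    simp [Face.hvAcross, Face.hv, Side.tri]

/-- Crossing a side is a honeycomb edge: the triangle on a side and the triangle across it are
adjacent. [cite: GlazmanManolescu2019, §1 (Fig. 2)] -/
theorem Face.hv_adj_hvAcross (f : Face) (s : Side) : hvGraph.Adj (f.hv s) (f.hvAcross s) := by
  obtain ⟨k, j⟩ := f
  cases s <;> simp [Face.hv, Face.hvAcross, Side.tri, hvGraph_adj, HV.AdjRel] <;> omega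

/-- The triangle across a side lies in a different rhombus: it is none of the two triangles of `f`.
[folklore] [cite: GlazmanManolescu2019, §1 (Fig. 2)] -/
theorem Face.hvAcross_ne_hv (f : Face) (s t : Side) : f.hvAcross s ≠ f.hv t := by
  obtain ⟨k, j⟩ := f
  cases s <;> cases t <;> simp [Face.hv, Face.hvAcross, Side.tri]

/-- The triangles across two different sides differ. [folklore] [cite: GlazmanManolescu2019, §1 (Fig. 2)] -/
theorem Face.hvAcross_inj (f : Face) {s t : Side} : f.hvAcross s = f.hvAcross t ↔ s = t := by
  obtain ⟨k, j⟩ := f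
  constructor
  · intro h; cases s <;> cases t <;> simp [Face.hvAcross] at h ⊢
  · rintro rfl; rfl

/-- Translating the rhombus translates its triangles. [folklore] [cite: GlazmanManolescu2019, §1 (Fig. 2)] -/
theorem Face.hv_eq_tr (f : Face) (s : Side) : f.hv s = HV.tr (-f.2, f.1) (Face.hv ((0 : ℤ), (0 : ℤ)) s) := by
  obtain ⟨k, j⟩ := f
  cases s <;> simp [Face.hv, HV.tr]

/-- Translating the rhombus translates the triangles across its sides. [folklore] [cite: GlazmanManolescu2019, §1 (Fig. 2)] -/
theorem Face.hvAcross_eq_tr (f : Face) (s : Side) :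
    f.hvAcross s = HV.tr (-f.2, f.1) (Face.hvAcross ((0 : ℤ), (0 : ℤ)) s) := by
  obtain ⟨k, j⟩ := f
  cases s <;> simp [Face.hvAcross, HV.tr] <;> omega

/-! ## §2. The local table: the rotation of an arc at `θ = π/3` is `π/3` times its honeycomb turns -/

/-- **The honeycomb turns of an arc** of the rhombus `f` from side `s` to side `t`, including the turn
at its first triangle seen from the triangle across `s` and the turn towards the triangle across `t`:
one turn for an arc inside one triangle, two for an arc through both. [cite: GlazmanManolescu2019, §1 (Fig. 2); §2.1 (wind(γ))] -/
def Face.arcPturn (f : Face) (s t : Side) : ℤ :=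
  if s.tri = t.tri then HV.turn (f.hvAcross s) (f.hv s) (f.hvAcross t)
  else HV.turn (f.hvAcross s) (f.hv s) (f.hv t) + HV.turn (f.hv s) (f.hv t) (f.hvAcross t)

/-- The honeycomb turns of an arc do not depend on the position of the rhombus. [folklore] [cite: GlazmanManolescu2019, §2.1 (wind(γ))] -/
theorem Face.arcPturn_eq_zero_zero (f : Face) (s t : Side) :
    f.arcPturn s t = Face.arcPturn ((0 : ℤ), (0 : ℤ)) s t := by
  simp only [Face.arcPturn, f.hv_eq_tr, f.hvAcross_eq_tr, HV.turn_tr]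

/-- The table at the origin rhombus. [folklore] -/
private theorem arcPturn_zero_table :
    Face.arcPturn ((0 : ℤ), (0 : ℤ)) .W .N = 1 ∧ Face.arcPturn ((0 : ℤ), (0 : ℤ)) .N .W = -1 ∧
    Face.arcPturn ((0 : ℤ), (0 : ℤ)) .S .E = -1 ∧ Face.arcPturn ((0 : ℤ), (0 : ℤ)) .E .S = 1 ∧
    Face.arcPturn ((0 : ℤ), (0 : ℤ)) .W .S = -2 ∧ Face.arcPturn ((0 : ℤ), (0 : ℤ)) .S .W = 2 ∧
    Face.arcPturn ((0 : ℤ), (0 : ℤ)) .N .E = 2 ∧ Face.arcPturn ((0 : ℤ), (0 : ℤ)) .E .N = -2 ∧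
    Face.arcPturn ((0 : ℤ), (0 : ℤ)) .W .E = 0 ∧ Face.arcPturn ((0 : ℤ), (0 : ℤ)) .E .W = 0 ∧
    Face.arcPturn ((0 : ℤ), (0 : ℤ)) .S .N = 0 ∧ Face.arcPturn ((0 : ℤ), (0 : ℤ)) .N .S = 0 := by
  decide

/-- ★ **THE LOCAL DICTIONARY**: at `θ = π/3` the rotation of an arc of a rhombus from side `s` to
side `t ≠ s` («`+θ` at the `θ`-corners …, `θ − π` / `π − θ` at the `(π−θ)`-corners, `0` for
straight arcs») equals `π/3` times the number of honeycomb turns (`±1` each, by `π/3`) of the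
corresponding one- or two-triangle path. [cite: GlazmanManolescu2019, §1 (Fig. 2: «H(Θ) becomes a triangular lattice … the model … becomes that on the hexagonal lattice»); §2.1 (definition of wind(γ))] -/
theorem arcTurn_pi_div_three_eq (f : Face) {s t : Side} (hst : s ≠ t) :
    arcTurn (π / 3) s t = π / 3 * f.arcPturn s t := by
  rw [f.arcPturn_eq_zero_zero]
  obtain ⟨h1, h2, h3, h4, h5, h6, h7, h8, h9, h10, h11, h12⟩ := arcPturn_zero_table
  cases s <;> cases t <;> first | exact absurd rfl hst |
    (simp only [arcTurn, h1, h2, h3, h4, h5, h6, h7, h8, h9, h10, h11, h12]; push_cast; ring)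

/-! ## §3. The honeycomb walk of a Yang–Baxter walk and its turning number -/

namespace HVAux

open HV

/-- Splitting a turn sum after a nonempty prefix: the turns of `M ++ y :: Q` are those of `M ++ [y]`
plus those of the path restarted at the last vertex of `M`. [folklore] [cite: DuminilCopinSmirnov2012, §2 (the winding as the total rotation along the walk)] -/
theorem pturn_append_cons_of_ne_nil (M : List HV) (hM : M ≠ []) (y : HV) (Q : List HV) :
    pturn (M ++ y :: Q) = pturn (M ++ [y]) + pturn (M.getLast hM :: y :: Q) := by
  obtain ⟨P, x, rfl⟩ : ∃ P x, M = P ++ [x] := by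
    rcases M.eq_nil_or_concat' with rfl | ⟨P, x, rfl⟩
    · exact absurd rfl hM
    · exact ⟨P, x, rfl⟩
  rw [List.getLast_concat, List.append_assoc, List.singleton_append, pturn_append_cons_cons,
    List.append_assoc, List.singleton_append]

end HVAux

namespace YBWalk

variable {D : Set Face} {a z : MidEdge} (γ : YBWalk D a z)

/-- The triangle across the entry side of the `i`-th arc (for `i = 0`: the triangle the walk comes
from; for `i ≥ 1`: the last triangle of the previous arc). [cite: GlazmanManolescu2019, §1 (Fig. 2)] -/
def acrossIn (i : ℕ) : HV := (γ.fc i).hvAcross (γ.sIn i)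

/-- The triangle across the exit side of the `i`-th arc (the first triangle of the next arc, or the
triangle beyond the final mid-edge). [cite: GlazmanManolescu2019, §1 (Fig. 2)] -/
def acrossOut (i : ℕ) : HV := (γ.fc i).hvAcross (γ.sOut i)

/-- **The honeycomb walk of a Yang–Baxter walk**: the triangle before the first mid-edge, the triangles
crossed (`hvInner`), and the triangle beyond the last mid-edge — a vertex list in the mid-edge-walk
format of `HexSAWStrip.lean` (for the trivial walk at the origin: DCS's trivial walk `[w, O]`).
[cite: GlazmanManolescu2019, §1 (Fig. 2: «the self-avoiding walk model … becomes that on the hexagonal lattice»)] -/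
def hvWalk : List HV :=
  γ.acrossIn 0 :: (if γ.arcs.length = 0 then [(γ.fc 0).hv (γ.sIn 0)] else γ.hvInner ++ [γ.acrossOut (γ.arcs.length - 1)])

/-- The `i`-th arc framed by the triangles across its two ends (3 or 4 honeycomb vertices).
[cite: GlazmanManolescu2019, §1 (Fig. 2)] -/
def framedArc (i : ℕ) : List HV := γ.acrossIn i :: (γ.arcHV i ++ [γ.acrossOut i])

variable {γ}

/-- The turning number of a framed arc is the tabulated local value. [cite: GlazmanManolescu2019, §2.1] -/
theorem pturn_framedArc (i : ℕ) : HV.pturn (γ.framedArc i) = (γ.fc i).arcPturn (γ.sIn i) (γ.sOut i) := by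
  unfold framedArc arcHV Face.arcPturn acrossIn acrossOut
  split_ifs with h
  · simp
  · simp [add_comm]

/-- Across the exit side of an arc lies the first triangle of the next arc. [folklore] [cite: GlazmanManolescu2019, §1 (Fig. 2)] -/
theorem acrossOut_eq_hv_succ {i : ℕ} (hi : i + 1 < γ.arcs.length) :
    γ.acrossOut i = (γ.fc (i + 1)).hv (γ.sIn (i + 1)) := by
  have h1 := (side_sIn (show i < γ.arcs.length by omega)).2.1
  have h2 := (side_sIn hi).1
  exact Face.hvAcross_eq_of_side_eq (h1.trans h2.symm) (fc_succ_ne hi)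

/-- Across the entry side of an arc lies the last triangle of the previous arc. [folklore] [cite: GlazmanManolescu2019, §1 (Fig. 2)] -/
theorem acrossIn_succ_eq_hv {i : ℕ} (hi : i + 1 < γ.arcs.length) :
    γ.acrossIn (i + 1) = (γ.fc i).hv (γ.sOut i) := by
  have h1 := (side_sIn (show i < γ.arcs.length by omega)).2.1
  have h2 := (side_sIn hi).1
  exact Face.hvAcross_eq_of_side_eq (h2.trans h1.symm) (fc_succ_ne hi).symm

/-- The framed prefix: the walk's triangles up to and including the `i`-th arc, framed by the
triangle before the first mid-edge and the triangle across the exit side of arc `i`. [folklore] [cite: GlazmanManolescu2019, §1 (Fig. 2)] -/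
def framedUpTo (γ : YBWalk D a z) (i : ℕ) : List HV := γ.acrossIn 0 :: (γ.hvUpTo (i + 1) ++ [γ.acrossOut i])

/-- The framed prefix through the last arc is the honeycomb walk. [folklore] [cite: GlazmanManolescu2019, §1 (Fig. 2)] -/
theorem framedUpTo_last (hn : 0 < γ.arcs.length) : γ.framedUpTo (γ.arcs.length - 1) = γ.hvWalk := by
  rw [framedUpTo, hvWalk, if_neg (by omega), hvInner, Nat.sub_add_cancel hn]

/-- The framed prefix through arc `0` is the framed arc `0`. [folklore] [cite: GlazmanManolescu2019, §1 (Fig. 2)] -/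
theorem framedUpTo_zero : γ.framedUpTo 0 = γ.framedArc 0 := by
  simp [framedUpTo, framedArc, hvUpTo]

/-- ★ **The turning number of the honeycomb walk is the sum of the local arc values.**
[cite: GlazmanManolescu2019, §2.1 (wind(γ) as the sum over the arcs)] -/
theorem pturn_framedUpTo {i : ℕ} (hi : i < γ.arcs.length) :
    HV.pturn (γ.framedUpTo i) = ∑ k ∈ Finset.range (i + 1), (γ.fc k).arcPturn (γ.sIn k) (γ.sOut k) := by
  induction i with
  | zero => rw [framedUpTo_zero, pturn_framedArc]; simp
  | succ i ih =>
    rw [Finset.sum_range_succ, ← ih (by omega)]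
    -- split the new arc off at the overlap of two vertices
    have hne : γ.acrossIn 0 :: γ.hvUpTo (i + 1) ≠ [] := List.cons_ne_nil _ _
    have hlast : (γ.acrossIn 0 :: γ.hvUpTo (i + 1)).getLast hne = (γ.fc i).hv (γ.sOut i) := by
      rw [List.getLast_cons (hvUpTo_ne_nil (by omega)), List.getLast_eq_iff_getLast?_eq_some,
        getLast?_hvUpTo_succ]
    obtain ⟨y, Q, hyQ, hy⟩ : ∃ y Q, γ.arcHV (i + 1) = y :: Q ∧ y = (γ.fc (i + 1)).hv (γ.sIn (i + 1)) := by
      have h := head?_arcHV (γ := γ) (i + 1)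
      match hQ : γ.arcHV (i + 1), h with
      | y :: Q, h => exact ⟨y, Q, rfl, by simpa using h⟩
    have e : γ.framedUpTo (i + 1) =
        (γ.acrossIn 0 :: γ.hvUpTo (i + 1)) ++ y :: (Q ++ [γ.acrossOut (i + 1)]) := by
      simp [framedUpTo, hvUpTo, hyQ]
    rw [e, HVAux.pturn_append_cons_of_ne_nil _ hne, hlast]
    congr 1
    · rw [framedUpTo, List.cons_append, hy, acrossOut_eq_hv_succ hi]
    · rw [← pturn_framedArc, framedArc, hyQ, acrossIn_succ_eq_hv hi, List.cons_append]

/-- ★★ **THE WINDING DICTIONARY.** At `Θ ≡ π/3` the rhombic winding of EVERY Yang–Baxter walk (any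
domain, any endpoints) is `π/3` times the honeycomb turning number of its triangle walk: Glazman–
Manolescu's `wind(γ)` IS Duminil-Copin–Smirnov's winding of the corresponding hexagonal-lattice walk.
[cite: GlazmanManolescu2019, §1 (Fig. 2) and §2.1 (eq. (2.1))] [cite: DuminilCopinSmirnov2012, §2 (the winding W_γ(a, z))] -/
theorem winding_pi_div_three_eq_pturn (γ : YBWalk D a z) :
    γ.winding (fun _ => π / 3) = π / 3 * HV.pturn γ.hvWalk := by
  rcases Nat.eq_zero_or_pos γ.arcs.length with h0 | hn
  · rw [winding_eq_sum, h0, Finset.sum_range_zero, hvWalk, if_pos h0]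
    simp
  · rw [winding_eq_sum, ← framedUpTo_last hn, pturn_framedUpTo (by omega), Nat.sub_add_cancel hn,
      Int.cast_sum, Finset.mul_sum]
    exact Finset.sum_congr rfl fun i hi => arcTurn_pi_div_three_eq _ (side_sIn (Finset.mem_range.1 hi)).2.2

end YBWalk

/-! ## §4. Weight and phase: the parafermionic weight at `π/3` is Duminil-Copin–Smirnov's -/

namespace YBWalk

variable {D : Set Face} {a z : MidEdge} (γ : YBWalk D a z)

/-- The honeycomb walk visits `|hvInner|` vertices between its first and last half-edge.
[cite: GlazmanManolescu2019, §1] -/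
theorem mwLen_hvWalk : HV.mwLen γ.hvWalk = γ.hvInner.length := by
  unfold hvWalk HV.mwLen
  split_ifs with h
  · rw [hvInner, h]; simp [hvUpTo]
  · simp

/-- ★ **The phase dictionary**: `exp(−i·(5/8)·wind(γ)) = λ^{pturn}` with DCS's `λ = exp(−5πi/24)`.
[cite: GlazmanManolescu2019, eq. (2.1) (σ = 5/8)] [cite: DuminilCopinSmirnov2012, Definition 1 (σ = 5/8)] -/
theorem exp_winding_pi_div_three :
    Complex.exp (((-(5 / 8 * γ.winding (fun _ => π / 3)) : ℝ) : ℂ) * Complex.I) = HV.lam ^ HV.pturn γ.hvWalk := by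
  rw [winding_pi_div_three_eq_pturn, HV.lam, ← Complex.exp_int_mul, HV.θ₅]
  congr 1
  push_cast
  ring

/-- ★★ **THE WEIGHT DICTIONARY (parafermionic)**: at `Θ ≡ π/3` the parafermionic weight
`w(γ) e^{−iσ·wind(γ)}` of a Yang–Baxter walk of nonzero weight IS Duminil-Copin–Smirnov's weight
`x_c^{ℓ} λ^{pturn}` of its honeycomb walk (the walks of weight zero are those through a rhombus
carrying two `u₂`-arcs, `w₂(π/3) = 0`). [cite: GlazmanManolescu2019, §1 (p. 3: «with weight 1/(√(2 − √2))^{|γ|}» [sic; x_c = 1/√(2+√2), §4: «(√(2+√2))^{−|γ|}»]) and eq. (2.1)] [cite: DuminilCopinSmirnov2012, Definition 1] -/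
theorem paraWeight_pi_div_three (hw : γ.weight (fun _ => π / 3) ≠ 0) :
    γ.paraWeight (fun _ => π / 3) = HV.pwt γ.hvWalk := by
  rw [paraWeight, exp_winding_pi_div_three, HV.pwt, mwLen_hvWalk, (weight_hex_eq γ).resolve_right hw]
  push_cast
  rfl

/-- The dichotomy form: either the parafermionic weight is DCS's weight of the honeycomb walk, or the
Yang–Baxter weight vanishes. [cite: GlazmanManolescu2019, §1 and eq. (2.1)] -/
theorem paraWeight_pi_div_three_or :
    γ.paraWeight (fun _ => π / 3) = HV.pwt γ.hvWalk ∨ γ.weight (fun _ => π / 3) = 0 := by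
  by_cases hw : γ.weight (fun _ => π / 3) = 0
  · exact Or.inr hw
  · exact Or.inl (γ.paraWeight_pi_div_three hw)

end YBWalk

/-! ## §5. Reading the mid-edges off the honeycomb walk (injectivity) -/

/-- The side between a triangle and the triangle across it, read by `edgeOf` (outward).
[cite: GlazmanManolescu2019, §1 (Fig. 2)] -/
theorem edgeOf_hv_hvAcross (f : Face) (s : Side) : edgeOf (f.hv s) (f.hvAcross s) = some (f.side s) := by
  obtain ⟨k, j⟩ := f
  cases s <;> simp [edgeOf, Face.hv, Face.hvAcross, Side.tri, Face.side]
  all_goals omega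

/-- The side between the triangle across and the triangle on it, read by `edgeOf` (inward).
[cite: GlazmanManolescu2019, §1 (Fig. 2)] -/
theorem edgeOf_hvAcross_hv (f : Face) (s : Side) : edgeOf (f.hvAcross s) (f.hv s) = some (f.side s) := by
  obtain ⟨k, j⟩ := f
  cases s <;> simp [edgeOf, Face.hv, Face.hvAcross, Side.tri, Face.side]
  all_goals omega

namespace YBWalk

variable {D : Set Face} {a z : MidEdge} (γ : YBWalk D a z)

/-- The last triangle crossed. [folklore] [cite: GlazmanManolescu2019, §1 (Fig. 2)] -/
theorem getLast_hvUpTo_length (hn : 0 < γ.arcs.length) :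
    (γ.hvUpTo γ.arcs.length).getLast (hvUpTo_ne_nil hn) =
      (γ.fc (γ.arcs.length - 1)).hv (γ.sOut (γ.arcs.length - 1)) := by
  obtain ⟨m, hm⟩ : ∃ m, γ.arcs.length = m + 1 := ⟨γ.arcs.length - 1, by omega⟩
  apply Option.some_injective
  rw [← List.getLast?_eq_some_getLast]
  simp only [hm, Nat.add_sub_cancel]
  exact getLast?_hvUpTo_succ m

/-- ★ **THE ENCODING IS INJECTIVE**: the mid-edges of a nontrivial Yang–Baxter walk are read off its
honeycomb walk as the rhombus sides crossed between consecutive triangles.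
[cite: GlazmanManolescu2019, §1 (Fig. 2)] -/
theorem pairEdges_hvWalk (hn : 0 < γ.arcs.length) : pairEdges γ.hvWalk = γ.mids := by
  have hstart : 0 < γ.arcs.length → edgeOf (γ.acrossIn 0) ((γ.fc 0).hv (γ.sIn 0)) = some a := fun _ => by
    rw [acrossIn, edgeOf_hvAcross_hv, (side_sIn hn).1, γ.getElem_zero]
  rw [hvWalk, if_neg (by omega), ← List.cons_append, pairEdges_append_cons _ (List.cons_ne_nil _ _),
    hvInner, pairEdges_cons_hvUpTo _ hstart le_rfl, List.getLast_cons (hvUpTo_ne_nil hn),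
    γ.getLast_hvUpTo_length hn, acrossOut, edgeOf_hv_hvAcross, Option.toList_some, pairEdges_singleton,
    List.append_nil]
  have hz : (γ.fc (γ.arcs.length - 1)).side (γ.sOut (γ.arcs.length - 1)) = z := by
    have h := (side_sIn (γ := γ) (i := γ.arcs.length - 1) (by omega)).2.1
    rw [h]
    simp only [show γ.arcs.length - 1 + 1 = γ.mids.length - 1 by have := γ.length_arcs; omega,
      γ.getElem_length_sub_one]
  rw [hz]
  conv_rhs => rw [← List.take_append_drop γ.arcs.length γ.mids]
  congr 1
  rw [γ.length_arcs, List.drop_eq_getElem_cons (by have := γ.length_pos; omega), γ.getElem_length_sub_one,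
    List.drop_eq_nil_of_le (by omega)]

/-- Injectivity on walks with the same endpoints: equal honeycomb walks force equal walks.
[cite: GlazmanManolescu2019, §1 (Fig. 2)] -/
theorem eq_of_hvWalk_eq {γ γ' : YBWalk D a z} (hn : 0 < γ.arcs.length) (hn' : 0 < γ'.arcs.length)
    (h : γ.hvWalk = γ'.hvWalk) : γ = γ' := by
  apply YBWalk.ext
  rw [← γ.pairEdges_hvWalk hn, ← γ'.pairEdges_hvWalk hn', h]

end YBWalk

/-! ## §6. Rooted walks: from the origin, the honeycomb walk is a Duminil-Copin–Smirnov mid-edge walk -/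

namespace YBWalk

variable {D : Set Face} {a z : MidEdge}

/-- The vertex before the last triangle of the honeycomb walk (inside the framed last arc): the last
triangle of the previous arc for a one-triangle last arc, else the first triangle of the last arc.
[folklore] [cite: GlazmanManolescu2019, §1 (Fig. 2)] -/
def prevTri (γ : YBWalk D a z) : HV :=
  if (γ.sIn (γ.arcs.length - 1)).tri = (γ.sOut (γ.arcs.length - 1)).tri then γ.acrossIn (γ.arcs.length - 1)
  else (γ.fc (γ.arcs.length - 1)).hv (γ.sIn (γ.arcs.length - 1))

/-- The last triangle crossed. [folklore] [cite: GlazmanManolescu2019, §1 (Fig. 2)] -/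
def lastTri (γ : YBWalk D a z) : HV := (γ.fc (γ.arcs.length - 1)).hv (γ.sOut (γ.arcs.length - 1))

variable (γ : YBWalk D a z)

/-- `hvUpTo` one step further. [folklore] [cite: GlazmanManolescu2019, §1 (Fig. 2)] -/
theorem hvUpTo_succ (i : ℕ) : γ.hvUpTo (i + 1) = γ.hvUpTo i ++ γ.arcHV i := rfl

/-- The last two vertices of the framed triangle list. [folklore] [cite: GlazmanManolescu2019, §1 (Fig. 2)] -/
theorem cons_hvInner_eq_append_pair (hn : 0 < γ.arcs.length) :
    ∃ M : List HV, γ.acrossIn 0 :: γ.hvInner = M ++ [γ.prevTri, γ.lastTri] := by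
  obtain ⟨m, hm⟩ : ∃ m, γ.arcs.length = m + 1 := ⟨γ.arcs.length - 1, by omega⟩
  have hml : m < γ.arcs.length := by omega
  rw [hvInner, hm, hvUpTo_succ, prevTri, lastTri]
  simp only [hm, Nat.add_sub_cancel]
  unfold arcHV
  split_ifs with ht
  · -- one-triangle last arc: the previous vertex is the last one of `acrossIn 0 :: hvUpTo m`
    have hne : γ.acrossIn 0 :: γ.hvUpTo m ≠ [] := List.cons_ne_nil _ _
    obtain ⟨P, x, hPx⟩ : ∃ P x, γ.acrossIn 0 :: γ.hvUpTo m = P ++ [x] := by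
      rcases (γ.acrossIn 0 :: γ.hvUpTo m).eq_nil_or_concat' with h | ⟨P, x, h⟩
      · exact absurd h hne
      · exact ⟨P, x, h⟩
    have hx : x = γ.acrossIn m := by
      have hl : (γ.acrossIn 0 :: γ.hvUpTo m).getLast hne = x := by simp [hPx]
      rw [← hl]
      rcases Nat.eq_zero_or_pos m with rfl | hm0
      · simp [hvUpTo]
      · obtain ⟨m', rfl⟩ : ∃ m', m = m' + 1 := ⟨m - 1, by omega⟩
        rw [List.getLast_cons (hvUpTo_ne_nil hm0), acrossIn_succ_eq_hv hml]
        apply Option.some_injective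
        rw [← List.getLast?_eq_some_getLast, getLast?_hvUpTo_succ]
    refine ⟨P, ?_⟩
    rw [← List.cons_append, hPx, hx, List.append_assoc]
    congr 1
    simp [Face.hv_eq_hv_iff.2 ⟨rfl, ht⟩]
  · exact ⟨γ.acrossIn 0 :: γ.hvUpTo m, by simp⟩

/-- The triangle beyond the final mid-edge is not the vertex before the last triangle: the honeycomb
walk does not retrace its last step. [folklore] [cite: DuminilCopinSmirnov2012, §1 (walks between mid-edges)] -/
theorem acrossOut_ne_prevTri (hn : 0 < γ.arcs.length) : γ.acrossOut (γ.arcs.length - 1) ≠ γ.prevTri := by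
  unfold prevTri acrossOut acrossIn
  split_ifs with ht
  · rw [Ne, Face.hvAcross_inj]
    exact (side_sIn (γ := γ) (i := γ.arcs.length - 1) (by omega)).2.2.symm
  · exact Face.hvAcross_ne_hv _ _ _

section Origin

variable {γ : YBWalk D origin z}

/-- **From the origin** (the western neighbour `(-1, 0)` of the rhombus `(0, 0)` lying outside the
domain), the first rhombus is `(0, 0)`, entered through its `W` side (also for the trivial walk, by
the junk conventions). [cite: GlazmanManolescu2019, §1 (the origin on the boundary)] -/
theorem fc_zero_of_origin (γ : YBWalk D origin z) (hD : ((-1 : ℤ), (0 : ℤ)) ∉ D) :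
    γ.fc 0 = (0, 0) ∧ γ.sIn 0 = .W := by
  rcases Nat.eq_zero_or_pos γ.arcs.length with h0 | hn
  · have harcs : γ.arcs = [] := List.eq_nil_of_length_eq_zero h0
    have hat : γ.arcAt 0 = (origin, origin) := by rw [arcAt, harcs]; rfl
    show faceOf (γ.arcAt 0) = _ ∧ sideIn (γ.arcAt 0) = _
    rw [hat]
    decide
  · obtain ⟨hs, -, -⟩ := side_sIn hn
    rw [γ.getElem_zero] at hs
    have hDm := (arcFace_arcAt hn).2
    rcases hfc : γ.fc 0 with ⟨k, l⟩
    rw [hfc] at hs hDm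
    cases hs0 : γ.sIn 0 <;> rw [hs0] at hs <;>
      simp only [Face.side, origin, MidEdge.vert.injEq, reduceCtorEq, Prod.mk.injEq, and_true] at hs ⊢
    · exact hs
    · exfalso
      obtain ⟨h1, h2⟩ := hs
      have e : ((k, l) : Face) = (-1, 0) := by ext <;> simp <;> omega
      exact hD (e ▸ hDm)

/-- From the origin, the triangle before the first mid-edge is DCS's outer vertex `w`.
[cite: DuminilCopinSmirnov2012, §2 (the root mid-edge a)] -/
theorem acrossIn_zero_of_origin (γ : YBWalk D origin z) (hD : ((-1 : ℤ), (0 : ℤ)) ∉ D) :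
    γ.acrossIn 0 = HV.wOut := by
  obtain ⟨h1, h2⟩ := γ.fc_zero_of_origin hD
  rw [acrossIn, h1, h2]
  rfl

/-- From the origin, the first triangle crossed is DCS's origin `O`. [cite: DuminilCopinSmirnov2012, §2] -/
theorem hv_zero_of_origin (γ : YBWalk D origin z) (hD : ((-1 : ℤ), (0 : ℤ)) ∉ D) :
    (γ.fc 0).hv (γ.sIn 0) = hvOrigin := by
  obtain ⟨h1, h2⟩ := γ.fc_zero_of_origin hD
  rw [h1, h2]
  rfl

/-- The honeycomb walk of the trivial walk at the origin is DCS's trivial walk `[w, O]`.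
[cite: DuminilCopinSmirnov2012, §3, proof of Lemma 2 («the only walk from a to a is a trivial one»)] -/
theorem hvWalk_of_origin_trivial (γ : YBWalk D origin z) (hD : ((-1 : ℤ), (0 : ℤ)) ∉ D)
    (h0 : γ.arcs.length = 0) : γ.hvWalk = [HV.wOut, hvOrigin] := by
  rw [hvWalk, if_pos h0, γ.acrossIn_zero_of_origin hD, γ.hv_zero_of_origin hD]

/-- The honeycomb walk of a nontrivial walk from the origin, in the format `w :: (inner ++ [u])`.
[cite: GlazmanManolescu2019, §1 (Fig. 2)] -/
theorem hvWalk_of_origin (γ : YBWalk D origin z) (hD : ((-1 : ℤ), (0 : ℤ)) ∉ D) (hn : 0 < γ.arcs.length) :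
    γ.hvWalk = HV.wOut :: (γ.hvInner ++ [γ.acrossOut (γ.arcs.length - 1)]) := by
  rw [hvWalk, if_neg (by omega), γ.acrossIn_zero_of_origin hD]

/-- The vertex before the last triangle, in the tree's `prevOf` form. [folklore] [cite: DuminilCopinSmirnov2012, §1 (walks between mid-edges)] -/
theorem prevOf_hvInner_of_origin (γ : YBWalk D origin z) (hD : ((-1 : ℤ), (0 : ℤ)) ∉ D)
    (hn : 0 < γ.arcs.length) : HV.prevOf γ.hvInner = γ.prevTri := by
  obtain ⟨M, hM⟩ := γ.cons_hvInner_eq_append_pair hn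
  rw [γ.acrossIn_zero_of_origin hD] at hM
  rcases M with _ | ⟨x, M'⟩
  · -- `hvInner = [lastTri]` and `prevTri = w`
    simp only [List.nil_append, List.cons.injEq] at hM
    obtain ⟨hp, hl⟩ := hM
    rw [hl, ← hp]
    simp [HV.prevOf]
  · simp only [List.cons_append, List.cons.injEq] at hM
    rw [hM.2, HV.prevOf_append_pair]

/-- ★★ **FROM THE ORIGIN, THE HONEYCOMB WALK OF A YANG–BAXTER WALK OF NONZERO WEIGHT IS A
SELF-AVOIDING MID-EDGE WALK OF DUMINIL-COPIN–SMIRNOV** in any honeycomb domain containing the triangles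
of the rhombic domain, from the root mid-edge `a = {w, O}`: the triangle list is a honeycomb path
(sides and short diagonals are honeycomb edges), starts `w, O`, visits distinct triangles of the
domain (two arcs of one rhombus of nonzero weight sit at opposite `θ`-corners), and its final
half-edge does not retrace. [cite: GlazmanManolescu2019, §1 (p. 3, Fig. 2)] [cite: DuminilCopinSmirnov2012, §1–§2 (walks between mid-edges)] -/
theorem isMidWalk_hvWalk_of_origin (γ : YBWalk D origin z) (hD : ((-1 : ℤ), (0 : ℤ)) ∉ D) {V : Finset HV}
    (hV : ∀ f ∈ D, ∀ s : Side, f.hv s ∈ V) (hw : γ.weight (fun _ => π / 3) ≠ 0) :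
    HV.IsMidWalk V γ.hvWalk := by
  rcases Nat.eq_zero_or_pos γ.arcs.length with h0 | hn
  · rw [γ.hvWalk_of_origin_trivial hD h0]; exact HV.isMidWalk_trivial V
  · have hne : γ.hvInner ≠ [] := hvUpTo_ne_nil hn
    rw [γ.hvWalk_of_origin hD hn, HV.isMidWalk_cons_append_iff V hne]
    refine ⟨isChain_hvUpTo le_rfl, ?_, ?_, ?_, nodup_hvUpTo hw le_rfl, ?_⟩
    · rw [hvInner, head?_hvUpTo hn, γ.hv_zero_of_origin hD]
    · rw [show γ.hvInner.getLast hne = _ from γ.getLast_hvUpTo_length hn, acrossOut]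
      exact Face.hv_adj_hvAcross _ _
    · intro x hx
      obtain ⟨k, hk, s, rfl⟩ := exists_fc_of_mem_hvUpTo hx
      exact hV _ (arcFace_arcAt hk).2 s
    · rw [γ.prevOf_hvInner_of_origin hD hn]
      exact γ.acrossOut_ne_prevTri hn

/-- From the origin the encoding is injective on ALL walks (the trivial one included): the mid-edges
are read off the honeycomb walk. [cite: GlazmanManolescu2019, §1 (Fig. 2)] -/
theorem pairEdges_hvWalk_of_origin (γ : YBWalk D origin z) (hD : ((-1 : ℤ), (0 : ℤ)) ∉ D) :
    pairEdges γ.hvWalk = γ.mids := by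
  rcases Nat.eq_zero_or_pos γ.arcs.length with h0 | hn
  · rw [γ.hvWalk_of_origin_trivial hD h0]
    have hl : γ.mids.length = 1 := by have := γ.length_arcs; have := γ.length_pos; omega
    obtain ⟨x, hx⟩ : ∃ x, γ.mids = [x] := List.length_eq_one_iff.1 hl
    have hx0 := γ.head_eq
    rw [hx] at hx0
    simp only [List.head?_cons, Option.some.injEq] at hx0
    rw [hx, hx0]
    simp [pairEdges, edgeOf, HV.wOut, hvOrigin, origin]
  · exact γ.pairEdges_hvWalk hn

/-- The final half-edge of the honeycomb walk of a nontrivial walk: from the last triangle across the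
final mid-edge `z`. [cite: DuminilCopinSmirnov2012, §1 (walks ending at a mid-edge)] -/
theorem finalDart_hvWalk_of_origin (γ : YBWalk D origin z) (hD : ((-1 : ℤ), (0 : ℤ)) ∉ D)
    (hn : 0 < γ.arcs.length) :
    HV.finalDart γ.hvWalk = (γ.lastTri, γ.acrossOut (γ.arcs.length - 1)) := by
  have hne : γ.hvInner ≠ [] := hvUpTo_ne_nil hn
  rw [γ.hvWalk_of_origin hD hn, HV.finalDart_cons_append hne]
  congr 1
  exact γ.getLast_hvUpTo_length hn

/-- The final half-edge crosses the final mid-edge `z`. [cite: GlazmanManolescu2019, §1 (Fig. 2)] -/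
theorem edgeOf_finalDart_hvWalk_of_origin (γ : YBWalk D origin z) (hD : ((-1 : ℤ), (0 : ℤ)) ∉ D)
    (hn : 0 < γ.arcs.length) :
    edgeOf (HV.finalDart γ.hvWalk).1 (HV.finalDart γ.hvWalk).2 = some z := by
  rw [γ.finalDart_hvWalk_of_origin hD hn, lastTri, acrossOut, edgeOf_hv_hvAcross]
  have h := (side_sIn (γ := γ) (i := γ.arcs.length - 1) (by omega)).2.1
  rw [h]
  simp only [show γ.arcs.length - 1 + 1 = γ.mids.length - 1 by have := γ.length_arcs; omega,
    γ.getElem_length_sub_one]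

end Origin

end YBWalk

/-! ## §7. Appending one arc: the honeycomb walk grows by the new arc's triangles (edition 2) -/

namespace YBWalk

variable {D : Set Face} {a z e a' : MidEdge}

section SnocArcs

variable {γ : YBWalk D a z} {δ : YBWalk D a' e} (harcs : δ.arcs = γ.arcs ++ [(z, e)])
include harcs

/-- Appending an arc adds one arc. [folklore] [cite: GlazmanManolescu2019, §1 (definition of the model)] -/
theorem length_of_arcs_snoc : δ.arcs.length = γ.arcs.length + 1 := by
  rw [harcs, List.length_append, List.length_singleton]

/-- The old arcs are unchanged. [folklore] [cite: GlazmanManolescu2019, §1 (definition of the model)] -/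
theorem arcAt_of_arcs_snoc_lt {i : ℕ} (hi : i < γ.arcs.length) : δ.arcAt i = γ.arcAt i := by
  rw [arcAt, arcAt, harcs, List.getD_eq_getElem' (by rw [List.length_append, List.length_singleton]; omega),
    List.getD_eq_getElem' hi, List.getElem_append_left hi]

/-- The new arc is the last one. [folklore] [cite: GlazmanManolescu2019, §1 (definition of the model)] -/
theorem arcAt_of_arcs_snoc_length : δ.arcAt γ.arcs.length = (z, e) := by
  rw [arcAt, harcs, List.getD_eq_getElem?_getD, List.getElem?_append_right le_rfl, Nat.sub_self]
  rfl

/-- Faces and sides of the old arcs are unchanged. [folklore] [cite: GlazmanManolescu2019, §1 (Fig. 2)] -/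
theorem fc_sIn_sOut_of_arcs_snoc_lt {i : ℕ} (hi : i < γ.arcs.length) :
    δ.fc i = γ.fc i ∧ δ.sIn i = γ.sIn i ∧ δ.sOut i = γ.sOut i := by
  simp only [fc, sIn, sOut, arcAt_of_arcs_snoc_lt harcs hi, and_self]

/-- The face and sides of the new arc. [folklore] [cite: GlazmanManolescu2019, §1 (Fig. 2)] -/
theorem fc_sIn_sOut_of_arcs_snoc_length {f : Face} {s t : Side} (hst : s ≠ t) (hz : f.side s = z)
    (he : f.side t = e) :
    δ.fc γ.arcs.length = f ∧ δ.sIn γ.arcs.length = s ∧ δ.sOut γ.arcs.length = t := by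
  have hf : arcFace (z, e) = some f := by rw [← hz, ← he]; exact arcFace_side_side f s t hst
  have hfc : δ.fc γ.arcs.length = f := by rw [fc, arcAt_of_arcs_snoc_length harcs, faceOf_eq hf]
  obtain ⟨h1, h2, -⟩ := side_sideIn hf
  refine ⟨hfc, ?_, ?_⟩
  · rw [sIn, arcAt_of_arcs_snoc_length harcs]
    exact f.side_injective (h1.trans hz.symm)
  · rw [sOut, arcAt_of_arcs_snoc_length harcs]
    exact f.side_injective (h2.trans he.symm)

/-- The old arcs' triangles are unchanged. [folklore] [cite: GlazmanManolescu2019, §1 (Fig. 2)] -/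
theorem arcHV_of_arcs_snoc_lt {i : ℕ} (hi : i < γ.arcs.length) : δ.arcHV i = γ.arcHV i := by
  obtain ⟨h1, h2, h3⟩ := fc_sIn_sOut_of_arcs_snoc_lt harcs hi
  simp only [arcHV, h1, h2, h3]

/-- The triangle list up to the old arcs is unchanged. [folklore] [cite: GlazmanManolescu2019, §1 (Fig. 2)] -/
theorem hvUpTo_of_arcs_snoc {i : ℕ} (hi : i ≤ γ.arcs.length) : δ.hvUpTo i = γ.hvUpTo i := by
  induction i with
  | zero => rfl
  | succ i ih => rw [hvUpTo_succ, hvUpTo_succ, ih (by omega), arcHV_of_arcs_snoc_lt harcs (by omega)]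

/-- The triangles crossed: the old ones followed by the new arc's. [cite: GlazmanManolescu2019, §1 (Fig. 2)] -/
theorem hvInner_of_arcs_snoc : δ.hvInner = γ.hvInner ++ δ.arcHV γ.arcs.length := by
  rw [hvInner, length_of_arcs_snoc harcs, hvUpTo_succ, hvUpTo_of_arcs_snoc harcs le_rfl, hvInner]

/-- The new arc's triangles. [cite: GlazmanManolescu2019, §1 (Fig. 2)] -/
theorem arcHV_of_arcs_snoc_length {f : Face} {s t : Side} (hst : s ≠ t) (hz : f.side s = z) (he : f.side t = e) :
    δ.arcHV γ.arcs.length = if s.tri = t.tri then [f.hv s] else [f.hv s, f.hv t] := by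
  obtain ⟨h1, h2, h3⟩ := fc_sIn_sOut_of_arcs_snoc_length harcs hst hz he
  simp only [arcHV, h1, h2, h3]

omit harcs in
/-- Across the old final mid-edge `z = f.side s`, seen from the old walk, lies the new arc's first
triangle (the old last arc not being drawn in `f`). [cite: GlazmanManolescu2019, §1 (Fig. 2)] -/
theorem acrossOut_last_eq_hv {f : Face} {s : Side} (hz : f.side s = z) (hn : 0 < γ.arcs.length)
    (hch : γ.fc (γ.arcs.length - 1) ≠ f) : γ.acrossOut (γ.arcs.length - 1) = f.hv s := by
  have h := (side_sIn (γ := γ) (i := γ.arcs.length - 1) (by omega)).2.1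
  have hz' : (γ.fc (γ.arcs.length - 1)).side (γ.sOut (γ.arcs.length - 1)) = z := by
    rw [h]
    simp only [show γ.arcs.length - 1 + 1 = γ.mids.length - 1 by have := γ.length_arcs; omega,
      γ.getElem_length_sub_one]
  exact Face.hvAcross_eq_of_side_eq (hz'.trans hz.symm) hch

omit harcs in
/-- ★ **The honeycomb walk after appending an arc** `s → t` of `f` to a nontrivial walk arriving at
`f.side s` from outside `f`: the old honeycomb walk (whose final vertex is already the new arc's first
triangle) followed by the rest of the new arc and the triangle across `t`.
[cite: GlazmanManolescu2019, §1 (Fig. 2)] -/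
theorem hvWalk_of_arcs_snoc (harcs : δ.arcs = γ.arcs ++ [(z, e)]) {f : Face} {s t : Side} (hst : s ≠ t)
    (hz : f.side s = z) (he : f.side t = e) (hn : 0 < γ.arcs.length) (hch : γ.fc (γ.arcs.length - 1) ≠ f) :
    δ.hvWalk = γ.hvWalk ++ ((if s.tri = t.tri then [] else [f.hv t]) ++ [f.hvAcross t]) := by
  have hn' : δ.arcs.length = γ.arcs.length + 1 := length_of_arcs_snoc harcs
  obtain ⟨h0f, h0s, -⟩ := fc_sIn_sOut_of_arcs_snoc_lt harcs hn
  obtain ⟨hf, -, ht⟩ := fc_sIn_sOut_of_arcs_snoc_length harcs hst hz he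
  rw [hvWalk, if_neg (by omega), hvWalk, if_neg (by omega), acrossIn, acrossIn, h0f, h0s, hn', Nat.add_sub_cancel,
    acrossOut, hf, ht, hvInner_of_arcs_snoc harcs, arcHV_of_arcs_snoc_length harcs hst hz he,
    acrossOut_last_eq_hv hz hn hch]
  split_ifs <;> simp

end SnocArcs

section SnocOrigin

variable {γ : YBWalk D origin z} {δ : YBWalk D origin e}

/-- From the origin, a rhombus of the domain with the origin as a side is `(0, 0)`, side `W`.
[cite: GlazmanManolescu2019, §1 (the origin on the boundary)] -/
theorem eq_zero_of_side_eq_origin (hD : ((-1 : ℤ), (0 : ℤ)) ∉ D) {f : Face} (hfD : f ∈ D) {s : Side}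
    (hs : f.side s = origin) : f = (0, 0) ∧ s = .W := by
  obtain ⟨k, l⟩ := f
  cases s <;> simp only [Face.side, origin, MidEdge.vert.injEq, reduceCtorEq, Prod.mk.injEq, and_true] at hs ⊢
  · exact hs
  · exfalso
    have e : ((k, l) : Face) = (-1, 0) := by ext <;> simp <;> omega
    exact hD (e ▸ hfD)

/-- ★ **The honeycomb walk after appending an arc, from the origin** — valid also when the old walk is
trivial (then `f = (0, 0)`, `s = W`, and the old honeycomb walk is `[w, O]`).
[cite: GlazmanManolescu2019, §1 (Fig. 2)] [cite: DuminilCopinSmirnov2012, §1 (the trivial walk)] -/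
theorem hvWalk_of_arcs_snoc_origin (hD : ((-1 : ℤ), (0 : ℤ)) ∉ D) (harcs : δ.arcs = γ.arcs ++ [(z, e)])
    {f : Face} (hfD : f ∈ D) {s t : Side} (hst : s ≠ t) (hz : f.side s = z) (he : f.side t = e)
    (hch : 0 < γ.arcs.length → γ.fc (γ.arcs.length - 1) ≠ f) :
    δ.hvWalk = γ.hvWalk ++ ((if s.tri = t.tri then [] else [f.hv t]) ++ [f.hvAcross t]) := by
  rcases Nat.eq_zero_or_pos γ.arcs.length with h0 | hn
  · -- the old walk is trivial: `z = origin`, `f = (0,0)`, `s = W`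
    have hz0 : z = origin := by
      have h := γ.nth_length
      rw [h0, nth_zero] at h
      exact h.symm
    subst hz0
    obtain ⟨rfl, rfl⟩ := eq_zero_of_side_eq_origin hD hfD hz
    have hn' : δ.arcs.length = γ.arcs.length + 1 := length_of_arcs_snoc harcs
    obtain ⟨hf, hs, ht⟩ := fc_sIn_sOut_of_arcs_snoc_length harcs hst hz he
    rw [h0] at hf hs ht hn'
    rw [γ.hvWalk_of_origin_trivial hD h0, hvWalk, if_neg (by omega), acrossIn, hf, hs, hn', hvInner, hn',
      hvUpTo_succ, hvUpTo, List.nil_append, acrossOut, Nat.add_sub_cancel, hf, ht, arcHV, hf, hs, ht]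
    have e1 : Face.hvAcross ((0 : ℤ), (0 : ℤ)) Side.W = HV.wOut := by decide
    have e2 : Face.hv ((0 : ℤ), (0 : ℤ)) Side.W = hvOrigin := by decide
    split_ifs <;> simp [e1, e2]
  · exact hvWalk_of_arcs_snoc harcs hst hz he hn (hch hn)

end SnocOrigin

end YBWalk

/-! ## §8. Honeycomb-side lemmas: triangle domains, neighbours of a triangle, crossed sides (edition 3) -/

/-- **The triangle set of a finite set of rhombi**: all triangles of all its rhombi (DCS's vertex
domain `V` for the rhombic domain at `θ = π/3`). [cite: GlazmanManolescu2019, §1 (Fig. 2)] -/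
def triSet (DF : Finset Face) : Finset HV := DF.biUnion fun f => {f.hv .W, f.hv .S}

/-- Membership in the triangle set. [cite: GlazmanManolescu2019, §1 (Fig. 2)] -/
theorem mem_triSet_iff {DF : Finset Face} {x : HV} : x ∈ triSet DF ↔ ∃ f ∈ DF, ∃ s : Side, x = f.hv s := by
  simp only [triSet, Finset.mem_biUnion, Finset.mem_insert, Finset.mem_singleton]
  constructor
  · rintro ⟨f, hf, h | h⟩
    · exact ⟨f, hf, .W, h⟩
    · exact ⟨f, hf, .S, h⟩
  · rintro ⟨f, hf, s, rfl⟩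
    refine ⟨f, hf, ?_⟩
    cases s
    · exact Or.inl rfl
    · exact Or.inr (Face.hv_eq_hv_iff.2 ⟨rfl, rfl⟩)
    · exact Or.inr rfl
    · exact Or.inl (Face.hv_eq_hv_iff.2 ⟨rfl, rfl⟩)

/-- The triangle set contains every triangle of every rhombus of the set. [cite: GlazmanManolescu2019, §1 (Fig. 2)] -/
theorem hv_mem_triSet {DF : Finset Face} {f : Face} (hf : f ∈ DF) (s : Side) : f.hv s ∈ triSet DF :=
  mem_triSet_iff.2 ⟨f, hf, s, rfl⟩

/-- DCS's outer vertex `w` is a triangle of the rhombus `(-1, 0)`; it lies outside the triangle set iff that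
rhombus is outside the set. [cite: DuminilCopinSmirnov2012, §2 (the root mid-edge a)] -/
theorem wOut_not_mem_triSet {DF : Finset Face} (hD : ((-1 : ℤ), (0 : ℤ)) ∉ DF) : HV.wOut ∉ triSet DF := by
  intro h
  obtain ⟨f, hf, s, hs⟩ := mem_triSet_iff.1 h
  obtain ⟨k, j⟩ := f
  have e : ((k, j) : Face) = (-1, 0) := by
    cases s <;> simp [Face.hv, HV.wOut, Side.tri] at hs <;> ext <;> simp <;> omega
  exact hD (e ▸ hf)

/-- **The three honeycomb neighbours of a triangle**: the other triangle of its rhombus (across the short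
diagonal) and the two triangles across its two rhombus sides. [cite: GlazmanManolescu2019, §1 (Fig. 2)] -/
theorem adj_hv_cases {g : Face} {τ : Side} {u : HV} (h : hvGraph.Adj (g.hv τ) u) :
    (∃ τ' : Side, τ'.tri ≠ τ.tri ∧ u = g.hv τ') ∨ (∃ t : Side, t.tri = τ.tri ∧ u = g.hvAcross t) := by
  rw [hvGraph_adj_iff_mem_nbrs] at h
  obtain ⟨k, j⟩ := g
  obtain ⟨x, y, b⟩ := u
  have eN : Face.hvAcross (k, j) .N = (-j - 1, k, true) := by
    show ((-(j + 1) : ℤ), k, true) = (-j - 1, k, true); congr 1; ring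
  have eS : Face.hvAcross (k, j) .S = (-j + 1, k, false) := by
    show ((-(j - 1) : ℤ), k, false) = (-j + 1, k, false); congr 1; ring
  cases τ <;> simp [HV.nbrs, Face.hv, Side.tri] at h <;> rcases h with ⟨rfl, rfl, rfl⟩ | ⟨rfl, rfl, rfl⟩ | ⟨rfl, rfl, rfl⟩
  -- τ = W : the W/N triangle `(-j, k, false)`; neighbours: diagonal partner, across N, across W
  · exact Or.inl ⟨.S, by decide, rfl⟩
  · exact Or.inr ⟨.N, by decide, eN.symm⟩
  · exact Or.inr ⟨.W, by decide, rfl⟩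
  -- τ = E : the S/E triangle `(-j, k, true)`; neighbours: diagonal partner, across S, across E
  · exact Or.inl ⟨.W, by decide, rfl⟩
  · exact Or.inr ⟨.S, by decide, eS.symm⟩
  · exact Or.inr ⟨.E, by decide, rfl⟩
  -- τ = S
  · exact Or.inl ⟨.W, by decide, rfl⟩
  · exact Or.inr ⟨.S, by decide, eS.symm⟩
  · exact Or.inr ⟨.E, by decide, rfl⟩
  -- τ = N
  · exact Or.inl ⟨.S, by decide, rfl⟩
  · exact Or.inr ⟨.N, by decide, eN.symm⟩
  · exact Or.inr ⟨.W, by decide, rfl⟩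

/-- **The two triangles bordering a rhombus side**, as read by `edgeOf`: a dart crossing the side `t` of
`g` goes from `g`'s triangle on `t` to the triangle across, or back. [cite: GlazmanManolescu2019, §1 (Fig. 2)] -/
theorem edgeOf_eq_some_side {p q : HV} {g : Face} {t : Side} (h : edgeOf p q = some (g.side t)) :
    (p = g.hv t ∧ q = g.hvAcross t) ∨ (p = g.hvAcross t ∧ q = g.hv t) := by
  obtain ⟨k, j⟩ := g
  obtain ⟨x, y, b⟩ := p
  obtain ⟨x', y', b'⟩ := q
  unfold edgeOf at h
  dsimp only at h
  by_cases c1 : b = true ∧ b' = false ∧ x' = x ∧ y' = y + 1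
  · rw [if_pos c1] at h
    obtain ⟨rfl, rfl, rfl, rfl⟩ := c1
    cases t <;> simp only [Option.some.injEq, Face.side, MidEdge.vert.injEq, reduceCtorEq] at h
    · obtain ⟨rfl, h2⟩ := h
      exact Or.inr ⟨by simp only [Face.hvAcross, Prod.mk.injEq, and_true]; omega, by simp only [Face.hv, Side.tri, Prod.mk.injEq, and_true]; omega⟩
    · obtain ⟨h1, h2⟩ := h
      exact Or.inl ⟨by simp only [Face.hv, Side.tri, Prod.mk.injEq, and_true]; omega, by simp only [Face.hvAcross, Prod.mk.injEq, and_true]; omega⟩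
  · rw [if_neg c1] at h
    by_cases c2 : b = false ∧ b' = true ∧ x' = x ∧ y = y' + 1
    · rw [if_pos c2] at h
      obtain ⟨rfl, rfl, rfl, hy⟩ := c2
      cases t <;> simp only [Option.some.injEq, Face.side, MidEdge.vert.injEq, reduceCtorEq] at h
      · obtain ⟨rfl, h2⟩ := h
        exact Or.inl ⟨by simp only [Face.hv, Side.tri, Prod.mk.injEq, and_true]; omega, by simp only [Face.hvAcross, Prod.mk.injEq, and_true]; omega⟩
      · obtain ⟨h1, h2⟩ := h
        exact Or.inr ⟨by simp only [Face.hvAcross, Prod.mk.injEq, and_true]; omega, by simp only [Face.hv, Side.tri, Prod.mk.injEq, and_true]; omega⟩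
    · rw [if_neg c2] at h
      by_cases c3 : b = false ∧ b' = true ∧ x = x' + 1 ∧ y' = y
      · rw [if_pos c3] at h
        obtain ⟨rfl, rfl, hx, rfl⟩ := c3
        cases t <;> simp only [Option.some.injEq, Face.side, MidEdge.slant.injEq, reduceCtorEq] at h
        · obtain ⟨rfl, h2⟩ := h
          exact Or.inr ⟨by simp only [Face.hvAcross, Prod.mk.injEq, and_true]; omega, by simp only [Face.hv, Side.tri, Prod.mk.injEq, and_true]; omega⟩
        · obtain ⟨h1, h2⟩ := h
          exact Or.inl ⟨by simp only [Face.hv, Side.tri, Prod.mk.injEq, and_true]; omega, by simp only [Face.hvAcross, Prod.mk.injEq, and_true]; omega⟩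
      · rw [if_neg c3] at h
        by_cases c4 : b = true ∧ b' = false ∧ x' = x + 1 ∧ y' = y
        · rw [if_pos c4] at h
          obtain ⟨rfl, rfl, rfl, rfl⟩ := c4
          cases t <;> simp only [Option.some.injEq, Face.side, MidEdge.slant.injEq, reduceCtorEq] at h
          · obtain ⟨rfl, h2⟩ := h
            exact Or.inl ⟨by simp only [Face.hv, Side.tri, Prod.mk.injEq, and_true]; omega, by simp only [Face.hvAcross, Prod.mk.injEq, and_true]; omega⟩
          · obtain ⟨h1, h2⟩ := h
            exact Or.inr ⟨by simp only [Face.hvAcross, Prod.mk.injEq, and_true]; omega, by simp only [Face.hv, Side.tri, Prod.mk.injEq, and_true]; omega⟩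
        · rw [if_neg c4] at h
          exact absurd h (by simp)

/-- Two arcs with the same ordered pair of mid-edges drawn as sides of two rhombi: the rhombi and the sides
agree. [folklore] [cite: GlazmanManolescu2019, §1 (Fig. 1)] -/
theorem Face.eq_of_side_pair_eq {f g : Face} {s t s' t' : Side} (hst : s ≠ t)
    (h1 : g.side s' = f.side s) (h2 : g.side t' = f.side t) : g = f ∧ s' = s ∧ t' = t := by
  by_cases hgf : g = f
  · subst hgf
    exact ⟨rfl, g.side_injective h1, g.side_injective h2⟩
  · exfalso
    rcases side_eq_side_cases h1 hgf with ⟨rfl, rfl, h⟩ | ⟨rfl, rfl, h⟩ | ⟨rfl, rfl, h⟩ | ⟨rfl, rfl, h⟩ <;>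
      rcases side_eq_side_cases h2 hgf with ⟨rfl, rfl, h'⟩ | ⟨rfl, rfl, h'⟩ | ⟨rfl, rfl, h'⟩ | ⟨rfl, rfl, h'⟩ <;>
      first | exact hst rfl | (obtain ⟨k, j⟩ := f; obtain ⟨k', j'⟩ := g; simp [Prod.mk.injEq] at h h'; omega)

/-- A dart out of a triangle crossing a rhombus side (rather than the short diagonal) goes to the triangle
across one of the two sides of that triangle. [cite: GlazmanManolescu2019, §1 (Fig. 2)] -/
theorem eq_hvAcross_of_edgeOf_hv {g : Face} {τ : Side} {u : HV} {e : MidEdge} (hadj : hvGraph.Adj (g.hv τ) u)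
    (h : edgeOf (g.hv τ) u = some e) : ∃ t : Side, t.tri = τ.tri ∧ u = g.hvAcross t ∧ e = g.side t := by
  rcases adj_hv_cases hadj with ⟨τ', -, rfl⟩ | ⟨t, ht, rfl⟩
  · rw [edgeOf_hv_hv] at h; exact absurd h (by simp)
  · refine ⟨t, ht, rfl, ?_⟩
    rw [← Face.hv_eq_hv_iff.2 ⟨rfl, ht⟩, edgeOf_hv_hvAcross] at h
    exact (Option.some_injective _ h).symm

namespace YBWalk

/-- **Membership in `pairEdges`**: a mid-edge is read off a triangle list iff some consecutive pair crosses it.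
[cite: GlazmanManolescu2019, §1 (Fig. 2)] -/
theorem mem_pairEdges_iff_edgeOf {e : MidEdge} : ∀ {L : List HV},
    e ∈ pairEdges L ↔ ∃ (i : ℕ) (hi : i + 1 < L.length), edgeOf L[i] L[i + 1] = some e
  | [] => by simp [pairEdges]
  | [v] => by simp [pairEdges]
  | v :: w :: l => by
    rw [pairEdges, List.mem_append, mem_pairEdges_iff_edgeOf (L := w :: l)]
    constructor
    · rintro (h | ⟨i, hi, h⟩)
      · refine ⟨0, by simp, ?_⟩
        rcases hvw : edgeOf v w with _ | e'
        · rw [hvw] at h; simp at h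
        · rw [hvw, Option.toList_some, List.mem_singleton] at h
          subst h; simpa using hvw
      · exact ⟨i + 1, by simpa using hi, by simpa using h⟩
    · rintro ⟨i, hi, h⟩
      rcases i with _ | i
      · left
        simp only [List.getElem_cons_zero, List.getElem_cons_succ] at h
        rw [h]; simp
      · right
        exact ⟨i, by simpa using hi, by simpa using h⟩

end YBWalk

namespace HVAux

open HV

/-- **Dropping the final vertex of a mid-edge walk** with at least one inner vertex beyond `O` gives a
mid-edge walk (its final half-edge runs into the former last inner vertex; no retracing since inner vertices
are distinct and different from `w`). [cite: DuminilCopinSmirnov2012, §1 (walks between mid-edges)] -/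
theorem isMidWalk_dropLast_cons_append {V : Finset HV} (hw : wOut ∉ V) {l : List HV} (hl : l ≠ []) {x u : HV}
    (h : IsMidWalk V (wOut :: ((l ++ [x]) ++ [u]))) : IsMidWalk V (wOut :: (l ++ [x])) := by
  have hl' : l ++ [x] ≠ [] := by simp
  rw [isMidWalk_cons_append_iff V hl'] at h
  obtain ⟨hc, hh, -, hV, hnd, -⟩ := h
  obtain ⟨hcl, -, hlast⟩ := List.isChain_append.1 hc
  rw [isMidWalk_cons_append_iff V hl]
  refine ⟨hcl, ?_, ?_, fun y hy => hV y (List.mem_append_left _ hy), hnd.sublist (List.sublist_append_left _ _), ?_⟩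
  · rcases l with _ | ⟨y, l⟩
    · exact absurd rfl hl
    · simpa using hh
  · exact hlast _ (by rw [Option.mem_def, List.getLast?_eq_some_getLast hl]) x (by simp)
  · intro hx
    rcases prevOf_mem l with h' | h'
    · rw [h'] at hx; exact hw (hx ▸ hV x (by simp))
    · rw [← hx] at h'
      exact (List.nodup_append.1 hnd).2.2 x h' x (List.mem_singleton_self _) rfl

end HVAux

namespace YBWalk

variable {D : Set Face} {a z : MidEdge}

/-- A visited rhombus has one of its triangles on the honeycomb walk. [cite: GlazmanManolescu2019, §1 (Fig. 2)] -/
theorem exists_hv_mem_hvInner_of_mem_facesVisited (γ : YBWalk D a z) {g : Face} (hg : g ∈ γ.facesVisited) :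
    ∃ σ : Side, g.hv σ ∈ γ.hvInner := by
  simp only [facesVisited, List.mem_toFinset, List.mem_filterMap] at hg
  obtain ⟨p, hp, hpg⟩ := hg
  obtain ⟨i, hi, rfl⟩ := List.mem_iff_getElem.1 hp
  have hfc : γ.fc i = g := by rw [fc, arcAt, List.getD_eq_getElem' hi, faceOf_eq hpg]
  refine ⟨γ.sIn i, ?_⟩
  rw [hvInner, mem_hvUpTo_iff]
  exact ⟨i, hi, by rw [mem_arcHV_iff, hfc]; exact Or.inl rfl⟩

/-- A straight arc joins triangles of different type. [folklore] [cite: GlazmanManolescu2019, §1 (Fig. 2)] -/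
theorem tri_ne_of_isWE_or_isSN {g g' : Face} {s t : Side} (hst : s ≠ t)
    (h : IsWE g' (g.side s, g.side t) ∨ IsSN g' (g.side s, g.side t)) : s.tri ≠ t.tri := by
  rcases h with (h | h) | (h | h) <;>
  · simp only [Prod.mk.injEq] at h
    obtain ⟨-, rfl, rfl⟩ := Face.eq_of_side_pair_eq hst h.1.symm h.2.symm
    decide

/-- The inner vertices of the honeycomb walk of a rooted walk are the triangles crossed.
[cite: GlazmanManolescu2019, §1 (Fig. 2)] -/
theorem inner_hvWalk_of_origin (γ : YBWalk D origin z) (hD : ((-1 : ℤ), (0 : ℤ)) ∉ D) :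
    HV.inner γ.hvWalk = γ.hvInner := by
  rcases Nat.eq_zero_or_pos γ.arcs.length with h0 | hn
  · rw [γ.hvWalk_of_origin_trivial hD h0, hvInner, h0]; rfl
  · rw [γ.hvWalk_of_origin hD hn, HV.inner_cons_append]

/-- The final half-edge of the honeycomb walk crosses the final mid-edge — for every rooted walk, the
trivial one included (`(w, O)` crosses the origin). [cite: GlazmanManolescu2019, §1 (Fig. 2)] -/
theorem edgeOf_finalDart_hvWalk_of_origin' (γ : YBWalk D origin z) (hD : ((-1 : ℤ), (0 : ℤ)) ∉ D) :
    edgeOf (HV.finalDart γ.hvWalk).1 (HV.finalDart γ.hvWalk).2 = some z := by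
  rcases Nat.eq_zero_or_pos γ.arcs.length with h0 | hn
  · have hz0 : z = origin := by
      have h := γ.nth_length
      rw [h0, nth_zero] at h
      exact h.symm
    subst hz0
    rw [γ.hvWalk_of_origin_trivial hD h0]
    decide
  · exact γ.edgeOf_finalDart_hvWalk_of_origin hD hn

end YBWalk

namespace HVAux

open HV

/-- The vertices of a mid-edge walk other than its exit vertex are pairwise distinct (`w` is off the
domain). [cite: DuminilCopinSmirnov2012, §1 (self-avoiding walks)] -/
theorem nodup_cons_of_isMidWalk {V : Finset HV} (hw : wOut ∉ V) {l : List HV} (hl : l ≠ []) {u : HV}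
    (h : IsMidWalk V (wOut :: (l ++ [u]))) : (wOut :: l).Nodup := by
  rw [isMidWalk_cons_append_iff V hl] at h
  obtain ⟨-, -, -, hV, hnd, -⟩ := h
  exact List.nodup_cons.2 ⟨fun hm => hw (hV _ hm), hnd⟩

/-- **Dropping the exit vertex**, general form (the inner list may reduce to `[O]`): a mid-edge walk
`w, l, x, u` restricts to the mid-edge walk `w, l, x` ending on the half-edge into `x`.
[cite: DuminilCopinSmirnov2012, §1 (walks between mid-edges)] -/
theorem isMidWalk_prefix {V : Finset HV} (hw : wOut ∉ V) {l : List HV} {x u : HV}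
    (h : IsMidWalk V (wOut :: ((l ++ [x]) ++ [u]))) : IsMidWalk V (wOut :: (l ++ [x])) := by
  rcases l.eq_nil_or_concat' with rfl | ⟨l', y, rfl⟩
  · have hx : x = hvOrigin := by
      have h2 := h.2.2.1
      simpa using h2
    subst hx
    exact isMidWalk_trivial V
  · exact isMidWalk_dropLast_cons_append hw (by simp) h

/-- The final dart of `w :: (l ++ [x])` starts at the last vertex of `w :: l` (also for `l = []`).
[cite: DuminilCopinSmirnov2012, §1] -/
theorem finalDart_cons_append' (l : List HV) (x : HV) :
    finalDart (wOut :: (l ++ [x])) = ((wOut :: l).getLast (List.cons_ne_nil _ _), x) := by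
  rcases l.eq_nil_or_concat' with rfl | ⟨l', y, rfl⟩
  · rfl
  · rw [finalDart_cons_append (by simp)]
    simp

/-- In a mid-edge walk `w, l, x, u` the vertex `x` does not occur in `w :: l`. [cite: DuminilCopinSmirnov2012, §1 (self-avoiding walks)] -/
theorem not_mem_of_isMidWalk {V : Finset HV} (hw : wOut ∉ V) {l : List HV} {x u : HV}
    (h : IsMidWalk V (wOut :: ((l ++ [x]) ++ [u]))) : x ∉ wOut :: l := by
  have hnd := nodup_cons_of_isMidWalk hw (by simp) h
  rw [← List.cons_append] at hnd
  intro hx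
  exact (List.nodup_append.1 hnd).2.2 x hx x (List.mem_singleton_self _) rfl

end HVAux

/-! ## §9. Surjectivity: every honeycomb mid-edge walk of the triangle domain ending on a rhombus side is
the honeycomb walk of a Yang–Baxter walk (edition 3) -/

/-- Transitivity of inequality on `Bool`: two values different from a third one agree. [folklore] -/
private theorem bool_eq_of_ne_of_ne {a b c : Bool} (h1 : a ≠ b) (h2 : b ≠ c) : a = c := by
  cases a <;> cases b <;> cases c <;> simp_all

namespace YBWalk

set_option maxHeartbeats 400000 in
open HV in
/-- ★★★ **SURJECTIVITY OF THE DICTIONARY.** Let `DF` be a finite set of rhombi not containing `(-1, 0)` (so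
that the origin mid-edge is on its boundary side of `(0,0)` or outside). Every self-avoiding mid-edge walk of
Duminil-Copin–Smirnov in the triangle domain `triSet DF` from the root `a = {w, O}` whose final half-edge
crosses a RHOMBUS SIDE (not a short diagonal) is the honeycomb walk of a Yang–Baxter walk of `DF` from the
origin. [cite: GlazmanManolescu2019, §1 (Fig. 2: «whose intersections with any walk is either void or one arc»)] [cite: DuminilCopinSmirnov2012, §1 (walks between mid-edges)] -/
theorem exists_hvWalk_eq (D : Set Face) (DF : Finset Face) (hDF : ∀ f, f ∈ D ↔ f ∈ DF)
    (hD' : ((-1 : ℤ), (0 : ℤ)) ∉ D) :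
    ∀ (n : ℕ) (P : List HV), P.length = n → HV.IsMidWalk (triSet DF) P →
      (edgeOf (HV.finalDart P).1 (HV.finalDart P).2).isSome →
      ∃ (z : MidEdge) (γ : YBWalk D origin z), γ.hvWalk = P := by
  have hD : ((-1 : ℤ), (0 : ℤ)) ∉ DF := fun h => hD' ((hDF _).2 h)
  have hw : wOut ∉ triSet DF := wOut_not_mem_triSet hD
  intro n
  induction n using Nat.strong_induction_on with
  | _ n ih =>
  intro P hPn hP hE
  rcases hP.trivial_or_exists with rfl | ⟨l, u, hl, rfl⟩
  · exact ⟨origin, YBWalk.trivial origin, (YBWalk.trivial origin).hvWalk_of_origin_trivial hD' (by simp)⟩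
  · -- `P = w :: (l₁ ++ [x] ++ [u])`, final dart `(x, u)` crossing the side `g.side t` outward from `x = g.hv t`
    obtain ⟨l₁, x, rfl⟩ : ∃ l₁ x, l = l₁ ++ [x] := by
      rcases l.eq_nil_or_concat' with h | ⟨l₁, x, h⟩
      · exact absurd h hl
      · exact ⟨l₁, x, h⟩
    have hfd : finalDart (wOut :: (l₁ ++ [x] ++ [u])) = (x, u) := by
      rw [finalDart_cons_append hl]; simp
    rw [hfd] at hE
    obtain ⟨e, he⟩ := Option.isSome_iff_exists.1 hE
    have hP' := hP
    rw [isMidWalk_cons_append_iff _ hl] at hP'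
    obtain ⟨-, -, hadj, hV, -, hret⟩ := hP'
    rw [List.getLast_append_singleton] at hadj
    obtain ⟨g, hgD, τ, hx⟩ := mem_triSet_iff.1 (hV x (by simp))
    subst hx
    obtain ⟨t, ht, rfl, rfl⟩ := eq_hvAcross_of_edgeOf_hv hadj he
    rw [Face.hv_eq_hv_iff.2 ⟨rfl, ht.symm⟩] at *
    clear ht τ
    have hgD' : g ∈ D := (hDF g).2 hgD
    -- the vertex `y` before `x`
    set y := (wOut :: l₁).getLast (List.cons_ne_nil _ _) with hy
    have hPeq : wOut :: (l₁ ++ [g.hv t] ++ [g.hvAcross t]) = (wOut :: l₁) ++ [g.hv t, g.hvAcross t] := by simp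
    have hyadj : hvGraph.Adj y (g.hv t) := by
      have hc := hP.1
      rw [hPeq] at hc
      obtain ⟨-, -, hj⟩ := List.isChain_append.1 hc
      exact hj y (by rw [Option.mem_def, List.getLast?_eq_some_getLast]) (g.hv t) (by simp)
    have hret' : g.hvAcross t ≠ y := by rwa [prevOf_append_singleton] at hret
    have hxnot : g.hv t ∉ wOut :: l₁ := HVAux.not_mem_of_isMidWalk hw hP
    rcases adj_hv_cases hyadj.symm with ⟨τ', hτ', hyeq⟩ | ⟨s, hs, hyeq⟩
    · ----------------------------------------------------------------
      -- CASE (i): `y` is the other triangle of `g`: the last arc crosses both triangles, `s → t`, `s.tri ≠ t.tri`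
      ----------------------------------------------------------------
      obtain ⟨l₂, y₀, rfl⟩ : ∃ l₂ y₀, l₁ = l₂ ++ [y₀] := by
        rcases l₁.eq_nil_or_concat' with h | ⟨l₂, y₀, h⟩
        · exfalso; subst h
          have : y = wOut := by simp [hy]
          rw [this] at hyeq
          exact hw (hyeq ▸ hv_mem_triSet hgD τ')
        · exact ⟨l₂, y₀, h⟩
      have hy₀ : y₀ = y := by simp [hy]
      rw [← hy₀] at hyeq
      subst hyeq
      -- the vertex `y'` before `y`
      set y' := (wOut :: l₂).getLast (List.cons_ne_nil _ _) with hy'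
      have hP1 : IsMidWalk (triSet DF) (wOut :: ((l₂ ++ [g.hv τ']) ++ [g.hv t])) :=
        HVAux.isMidWalk_prefix hw (by simpa using hP)
      have hP2 : IsMidWalk (triSet DF) (wOut :: (l₂ ++ [g.hv τ'])) := HVAux.isMidWalk_prefix hw hP1
      have hy'adj : hvGraph.Adj y' (g.hv τ') := by
        have hc := hP2.1
        rw [show wOut :: (l₂ ++ [g.hv τ']) = (wOut :: l₂) ++ [g.hv τ'] by simp] at hc
        obtain ⟨-, -, hj⟩ := List.isChain_append.1 hc
        exact hj y' (by rw [Option.mem_def, List.getLast?_eq_some_getLast]) (g.hv τ') (by simp)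
      have hynot : g.hv τ' ∉ wOut :: l₂ := HVAux.not_mem_of_isMidWalk hw hP1
      have hxnot2 : g.hv t ∉ wOut :: (l₂ ++ [g.hv τ']) := by simpa using hxnot
      -- `y'` is across a side `s` of `g` with `s.tri = τ'.tri`
      obtain ⟨s, hs, hy'eq⟩ : ∃ s : Side, s.tri = τ'.tri ∧ y' = g.hvAcross s := by
        rcases adj_hv_cases hy'adj.symm with ⟨τ'', hτ'', h⟩ | ⟨s, hs, h⟩
        · exfalso
          have htt : τ''.tri = t.tri := bool_eq_of_ne_of_ne hτ'' hτ'
          rw [Face.hv_eq_hv_iff.2 ⟨rfl, htt⟩] at h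
          have hmem : y' ∈ wOut :: (l₂ ++ [g.hv τ']) := by
            have := List.getLast_mem (List.cons_ne_nil wOut l₂)
            rw [← hy'] at this
            simp only [List.mem_cons, List.mem_append] at this ⊢
            tauto
          exact hxnot2 (h ▸ hmem)
        · exact ⟨s, hs, h⟩
      have hst : s ≠ t := by rintro rfl; exact hτ' hs.symm
      -- induction hypothesis on `P'' = w :: (l₂ ++ [y])`
      have hlen : (wOut :: (l₂ ++ [g.hv τ'])).length < n := by rw [← hPn]; simp
      have hfd2 : finalDart (wOut :: (l₂ ++ [g.hv τ'])) = (y', g.hv τ') := HVAux.finalDart_cons_append' _ _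
      have hE2 : (edgeOf (finalDart (wOut :: (l₂ ++ [g.hv τ']))).1 (finalDart (wOut :: (l₂ ++ [g.hv τ']))).2).isSome := by
        rw [hfd2, hy'eq, ← Face.hv_eq_hv_iff.2 ⟨rfl, hs⟩, edgeOf_hvAcross_hv]; rfl
      obtain ⟨z', γ', hγ'⟩ := ih _ hlen _ rfl hP2 hE2
      have hz' : z' = g.side s := by
        have h1 := γ'.edgeOf_finalDart_hvWalk_of_origin' hD'
        rw [hγ', hfd2, hy'eq, ← Face.hv_eq_hv_iff.2 ⟨rfl, hs⟩, edgeOf_hvAcross_hv] at h1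
        exact (Option.some_injective _ h1).symm
      subst hz'
      have hinner : γ'.hvInner = l₂ := by
        rw [← γ'.inner_hvWalk_of_origin hD', hγ', HV.inner_cons_append]
      -- no arc of `γ'` lies in `g` (both triangles of `g` are `x`, `y`, off `l₂`)
      have hnog : ∀ p ∈ γ'.arcs, arcFace p ≠ some g := by
        intro p hp hpg
        obtain ⟨σ, hσ⟩ := γ'.exists_hv_mem_hvInner_of_mem_facesVisited (γ'.mem_facesVisited_of_arcFace hp hpg)
        rw [hinner] at hσ
        by_cases hσt : σ.tri = t.tri
        · rw [Face.hv_eq_hv_iff.2 ⟨rfl, hσt⟩] at hσ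
          exact hxnot2 (by simp [hσ])
        · have hσ' : σ.tri = τ'.tri := bool_eq_of_ne_of_ne hσt hτ'.symm
          rw [Face.hv_eq_hv_iff.2 ⟨rfl, hσ'⟩] at hσ
          exact hynot (List.mem_cons_of_mem _ hσ)
      have hf : arcFace (g.side s, g.side t) = some g := arcFace_side_side g s t hst
      have hemids : g.side t ∉ γ'.mids := by
        rw [← γ'.pairEdges_hvWalk_of_origin hD', hγ', mem_pairEdges_iff_edgeOf]
        rintro ⟨i, hi, hcross⟩
        rcases edgeOf_eq_some_side hcross with ⟨h1, -⟩ | ⟨-, h2⟩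
        · exact hxnot2 (by rw [← h1]; exact List.getElem_mem _)
        · exact hxnot2 (by rw [← h2]; exact List.getElem_mem _)
      have hch : ∀ i, i + 1 = γ'.arcs.length → arcFace (γ'.nth i, g.side s) ≠ some g := by
        intro i hi hface
        have hmem : (γ'.nth i, g.side s) ∈ γ'.arcs := by
          have := γ'.arc_nth_mem (i := i) (by omega)
          rwa [show i + 1 = γ'.arcs.length from hi, nth_length] at this
        exact hnog _ hmem hface
      have hnc₁' : ∀ g₁, IsWE g₁ (g.side s, g.side t) → ∀ i < γ'.arcs.length, ¬IsSN g₁ (γ'.nth i, γ'.nth (i + 1)) := by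
        intro g₁ h i hi hSN
        have hg : g₁ = g := by
          rcases h with h | h <;>
          · simp only [Prod.mk.injEq] at h
            exact (Face.eq_of_side_pair_eq hst h.1.symm h.2.symm).1
        subst hg
        exact hnog _ (γ'.arc_nth_mem hi) (arcFace_of_isSN hSN)
      have hnc₂' : ∀ g₁, IsSN g₁ (g.side s, g.side t) → ∀ i < γ'.arcs.length, ¬IsWE g₁ (γ'.nth i, γ'.nth (i + 1)) := by
        intro g₁ h i hi hWE
        have hg : g₁ = g := by
          rcases h with h | h <;>
          · simp only [Prod.mk.injEq] at h
            exact (Face.eq_of_side_pair_eq hst h.1.symm h.2.symm).1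
        subst hg
        exact hnog _ (γ'.arc_nth_mem hi) (arcFace_of_isWE hWE)
      have harcs : (γ'.snoc (g.side t) g hf hgD' hemids hch (hnc₁' g) (hnc₂' g)).arcs = γ'.arcs ++ [(g.side s, g.side t)] :=
        γ'.snoc_arcs _ _ hf hgD' hemids hch _ _
      have hch' : 0 < γ'.arcs.length → γ'.fc (γ'.arcs.length - 1) ≠ g := by
        intro hn' hfc
        have h1 := (arcFace_arcAt (γ := γ') (i := γ'.arcs.length - 1) (by omega)).1
        rw [hfc] at h1
        exact hnog _ (arcAt_mem (by omega)) h1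
      refine ⟨g.side t, γ'.snoc (g.side t) g hf hgD' hemids hch (hnc₁' g) (hnc₂' g), ?_⟩
      rw [hvWalk_of_arcs_snoc_origin hD' harcs hgD' hst rfl rfl hch', hγ', if_neg (by rw [hs]; exact hτ')]
      simp
    · ----------------------------------------------------------------
      -- CASE (ii): `y` is across the side `s` of `g`: the last arc is the single triangle `x`, `s → t`
      ----------------------------------------------------------------
      have hst : s ≠ t := by rintro rfl; exact hret' hyeq.symm
      have hP2 : IsMidWalk (triSet DF) (wOut :: (l₁ ++ [g.hv t])) := HVAux.isMidWalk_prefix hw hP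
      have hlen : (wOut :: (l₁ ++ [g.hv t])).length < n := by rw [← hPn]; simp
      have hfd2 : finalDart (wOut :: (l₁ ++ [g.hv t])) = (y, g.hv t) := HVAux.finalDart_cons_append' _ _
      have hxs : g.hv t = g.hv s := Face.hv_eq_hv_iff.2 ⟨rfl, hs.symm⟩
      have hE2 : (edgeOf (finalDart (wOut :: (l₁ ++ [g.hv t]))).1 (finalDart (wOut :: (l₁ ++ [g.hv t]))).2).isSome := by
        rw [hfd2, hyeq, hxs, edgeOf_hvAcross_hv]; rfl
      obtain ⟨z', γ', hγ'⟩ := ih _ hlen _ rfl hP2 hE2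
      have hz' : z' = g.side s := by
        have h1 := γ'.edgeOf_finalDart_hvWalk_of_origin' hD'
        rw [hγ', hfd2, hyeq, hxs, edgeOf_hvAcross_hv] at h1
        exact (Option.some_injective _ h1).symm
      subst hz'
      have hinner : γ'.hvInner = l₁ := by
        rw [← γ'.inner_hvWalk_of_origin hD', hγ', HV.inner_cons_append]
      have hnodup : (wOut :: (l₁ ++ [g.hv t])).Nodup := by
        have := HVAux.nodup_cons_of_isMidWalk hw hl hP
        simpa using this
      have hf : arcFace (g.side s, g.side t) = some g := arcFace_side_side g s t hst
      have hemids : g.side t ∉ γ'.mids := by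
        rw [← γ'.pairEdges_hvWalk_of_origin hD', hγ', mem_pairEdges_iff_edgeOf]
        rintro ⟨i, hi, hcross⟩
        have hlast : (wOut :: (l₁ ++ [g.hv t]))[l₁.length + 1]'(by simp) = g.hv t := by
          simp [List.getElem_cons_succ]
        rcases edgeOf_eq_some_side hcross with ⟨h1, -⟩ | ⟨h1, h2⟩
        · have := (hnodup.getElem_inj_iff).1 (h1.trans hlast.symm)
          simp at hi this
          omega
        · have hi1 := (hnodup.getElem_inj_iff).1 (h2.trans hlast.symm)
          have hi0 : i = l₁.length := by simp at hi1; omega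
          subst hi0
          have hiy : (wOut :: (l₁ ++ [g.hv t]))[l₁.length]'(by simp) = y := by
            have e1 : (wOut :: (l₁ ++ [g.hv t]))[l₁.length]'(by simp) = (wOut :: l₁)[l₁.length]'(by simp) := by
              show ((wOut :: l₁) ++ [g.hv t])[l₁.length]'(by simp) = _
              exact List.getElem_append_left (by simp)
            rw [e1, hy, List.getLast_eq_getElem]
            simp
          rw [hiy, hyeq] at h1
          exact hst ((Face.hvAcross_inj g).1 h1)
      -- the last arc of `γ'` is not in `g`: its last triangle is `y = g.hvAcross s`
      have hch' : 0 < γ'.arcs.length → γ'.fc (γ'.arcs.length - 1) ≠ g := by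
        intro hn' hfc
        have h1 := γ'.getLast_hvUpTo_length hn'
        rw [hfc] at h1
        have hl₁ : l₁ ≠ [] := by rw [← hinner]; exact hvUpTo_ne_nil hn'
        have h2 : (γ'.hvUpTo γ'.arcs.length).getLast (hvUpTo_ne_nil hn') = y := by
          rw [hy]
          have e : γ'.hvUpTo γ'.arcs.length = l₁ := hinner
          simp only [e, List.getLast_cons hl₁]
        rw [h2, hyeq] at h1
        exact Face.hvAcross_ne_hv g s _ h1
      have hch : ∀ i, i + 1 = γ'.arcs.length → arcFace (γ'.nth i, g.side s) ≠ some g := by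
        intro i hi hface
        have hn' : 0 < γ'.arcs.length := by omega
        have hmem : (γ'.nth i, g.side s) ∈ γ'.arcs := by
          have := γ'.arc_nth_mem (i := i) (by omega)
          rwa [show i + 1 = γ'.arcs.length from hi, nth_length] at this
        obtain ⟨j, hj, hje⟩ := List.mem_iff_getElem.1 hmem
        have h1 := (arcFace_arcAt (γ := γ') (i := j) hj).1
        rw [arcAt, List.getD_eq_getElem' hj, hje, hface] at h1
        -- `fc j = g`; and `j = arcs.length - 1` since the arc ends at `z'`
        have hjlast : j = γ'.arcs.length - 1 := by
          have e2 := γ'.arcs_getElem_eq_nth hj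
          rw [hje, Prod.mk.injEq] at e2
          have := γ'.nth_inj (i := γ'.arcs.length) (j := j + 1) le_rfl (by omega) (by rw [nth_length]; exact e2.2)
          omega
        subst hjlast
        exact hch' hn' (Option.some_injective _ h1).symm
      have hnc₁' : ∀ g₁, IsWE g₁ (g.side s, g.side t) → ∀ i < γ'.arcs.length, ¬IsSN g₁ (γ'.nth i, γ'.nth (i + 1)) :=
        fun g₁ h _ _ _ => absurd hs (tri_ne_of_isWE_or_isSN hst (Or.inl h))
      have hnc₂' : ∀ g₁, IsSN g₁ (g.side s, g.side t) → ∀ i < γ'.arcs.length, ¬IsWE g₁ (γ'.nth i, γ'.nth (i + 1)) :=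
        fun g₁ h _ _ _ => absurd hs (tri_ne_of_isWE_or_isSN hst (Or.inr h))
      have harcs : (γ'.snoc (g.side t) g hf hgD' hemids hch (hnc₁' g) (hnc₂' g)).arcs = γ'.arcs ++ [(g.side s, g.side t)] :=
        γ'.snoc_arcs _ _ hf hgD' hemids hch _ _
      refine ⟨g.side t, γ'.snoc (g.side t) g hf hgD' hemids hch (hnc₁' g) (hnc₂' g), ?_⟩
      rw [hvWalk_of_arcs_snoc_origin hD' harcs hgD' hst rfl rfl hch', hγ', if_pos hs]
      simp


end YBWalk

/-! ## §10. The weight criterion: at `θ = π/3` the Yang–Baxter weight is nonzero exactly when the honeycomb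
walk is self-avoiding (edition 3) -/

/-- The shapes of nonzero local weight at `π/3`: no arc, one arc, or two `θ`-corner arcs.
[cite: GlazmanManolescu2019, §1 («if θ = π/3, then w₂ = 0 and v = w₁ = u₂ = u₁²»)] -/
theorem shape_of_localWeight_pi_div_three_ne_zero {l : List ArcKind} (h : localWeight (π / 3) l ≠ 0) :
    l = [] ∨ (∃ κ, κ ≠ .degen ∧ l = [κ]) ∨ l = [.corner, .corner] := by
  rcases l with _ | ⟨κ₁, _ | ⟨κ₂, _ | ⟨κ₃, l⟩⟩⟩
  · exact Or.inl rfl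
  · refine Or.inr (Or.inl ⟨κ₁, ?_, rfl⟩)
    rintro rfl; exact h rfl
  · cases κ₁ <;> cases κ₂ <;> first | exact Or.inr (Or.inr rfl) | exact absurd rfl h |
      exact absurd (by simp [localWeight, weightW2_pi_div_three]) h
  · exact absurd (by cases κ₁ <;> cases κ₂ <;> rfl) h

/-- One arc of any kind weighs `x_c` or `x_c²` at `π/3`. [cite: GlazmanManolescu2019, §1 («v = w₁ = u₂ = u₁²»)] -/
theorem localWeight_pi_div_three_single_ne_zero {κ : ArcKind} (hκ : κ ≠ .degen) : localWeight (π / 3) [κ] ≠ 0 := by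
  have hx := hexCriticalFugacity_pos_lt_one.1
  cases κ
  · simp [localWeight, weightU1_pi_div_three, hx.ne']
  · simp [localWeight, weightU2_pi_div_three, hx.ne']
  · simp [localWeight, weightV_pi_div_three, hx.ne']
  · exact absurd rfl hκ

/-- Two `θ`-corner arcs weigh `w₁ = x_c² ≠ 0` at `π/3`. [cite: GlazmanManolescu2019, §1 («v = w₁ = u₂ = u₁²»)] -/
theorem localWeight_pi_div_three_corner_corner_ne_zero : localWeight (π / 3) [.corner, .corner] ≠ 0 := by
  have hx := hexCriticalFugacity_pos_lt_one.1
  simp [localWeight, weightW1_pi_div_three, hx.ne']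

/-- Two hits of a `filterMap` come from two distinct positions. [folklore] -/
private theorem exists_two_of_two_le_length_filterMap {α β : Type*} (g : α → Option β) :
    ∀ (l : List α), 2 ≤ (l.filterMap g).length →
      ∃ (i j : ℕ) (hi : i < l.length) (hj : j < l.length), i < j ∧ (g l[i]).isSome ∧ (g l[j]).isSome
  | [], h => by simp at h
  | p :: l, h => by
    rw [List.filterMap_cons] at h
    rcases hgp : g p with _ | b
    · rw [hgp] at h
      obtain ⟨i, j, hi, hj, hij, hgi, hgj⟩ := exists_two_of_two_le_length_filterMap g l h
      exact ⟨i + 1, j + 1, by simpa using hi, by simpa using hj, by omega, by simpa using hgi, by simpa using hgj⟩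
    · rw [hgp] at h
      simp only [List.length_cons] at h
      have h1 : 1 ≤ (l.filterMap g).length := by omega
      obtain ⟨c, hc⟩ := List.exists_mem_of_length_pos (by omega : 0 < (l.filterMap g).length)
      obtain ⟨q, hq, hgq⟩ := List.mem_filterMap.1 hc
      obtain ⟨j, hj, rfl⟩ := List.mem_iff_getElem.1 hq
      exact ⟨0, j + 1, by simp, by simpa using hj, by omega, by simp [hgp], by simp [hgq]⟩

/-- An arc between two different sides is not degenerate. [folklore] [cite: GlazmanManolescu2019, §1 (Fig. 1)] -/
theorem arcKind_ne_degen {s t : Side} (hst : s ≠ t) : arcKind s t ≠ .degen := by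
  cases s <;> cases t <;> first | exact absurd rfl hst | decide

namespace YBWalk

variable {D : Set Face} {a z : MidEdge}

/-- A kind listed for the rhombus `f` comes from an arc of the walk drawn in `f`.
[cite: GlazmanManolescu2019, §1 (Fig. 1)] -/
theorem exists_arc_of_mem_kindsIn (γ : YBWalk D a z) {f : Face} {κ : ArcKind} (h : κ ∈ γ.kindsIn f) :
    ∃ i < γ.arcs.length, γ.fc i = f ∧ arcKind (γ.sIn i) (γ.sOut i) = κ := by
  simp only [kindsIn, List.mem_filterMap] at h
  obtain ⟨p, hp, hpκ⟩ := h
  obtain ⟨i, hi, rfl⟩ := List.mem_iff_getElem.1 hp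
  obtain ⟨hfa, hk⟩ := arcKindOf_getElem (γ := γ) hi
  by_cases hf : arcFace γ.arcs[i] = some f
  · rw [if_pos hf, hk, Option.some.injEq] at hpκ
    rw [hfa, Option.some.injEq] at hf
    exact ⟨i, hi, hf, hpκ⟩
  · rw [if_neg hf] at hpκ; exact absurd hpκ (by simp)

/-- Two kinds listed for `f` come from two different arcs drawn in `f`. [cite: GlazmanManolescu2019, §1 (Fig. 1)] -/
theorem exists_two_arcs_of_two_le_length_kindsIn (γ : YBWalk D a z) {f : Face} (h : 2 ≤ (γ.kindsIn f).length) :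
    ∃ i j, i < j ∧ j < γ.arcs.length ∧ γ.fc i = f ∧ γ.fc j = f := by
  obtain ⟨i, j, hi, hj, hij, hgi, hgj⟩ := exists_two_of_two_le_length_filterMap _ γ.arcs h
  have hfi : γ.fc i = f := by
    by_cases hf : arcFace γ.arcs[i] = some f
    · rw [(arcKindOf_getElem (γ := γ) hi).1, Option.some.injEq] at hf; exact hf
    · simp [hf] at hgi
  have hfj : γ.fc j = f := by
    by_cases hf : arcFace γ.arcs[j] = some f
    · rw [(arcKindOf_getElem (γ := γ) hj).1, Option.some.injEq] at hf; exact hf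
    · simp [hf] at hgj
  exact ⟨i, j, hij, hj, hfi, hfj⟩

/-- Both triangles of a rhombus carrying a two-triangle arc, or two arcs, are on the honeycomb walk.
[cite: GlazmanManolescu2019, §1 (Fig. 2)] -/
theorem hv_mem_hvInner_of_kindsIn (γ : YBWalk D a z) {f : Face}
    (h : (∃ κ, κ ≠ .corner ∧ κ ∈ γ.kindsIn f) ∨ 2 ≤ (γ.kindsIn f).length) (σ : Side) :
    f.hv σ ∈ γ.hvInner := by
  rw [hvInner, mem_hvUpTo_iff]
  rcases h with ⟨κ, hκ, hmem⟩ | h2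
  · -- a non-corner arc crosses both triangles
    obtain ⟨i, hi, hfi, hk⟩ := γ.exists_arc_of_mem_kindsIn hmem
    have hst := (side_sIn hi).2.2
    have htri : (γ.sIn i).tri ≠ (γ.sOut i).tri := fun e => hκ (hk ▸ (arcKind_eq_corner_iff hst).2 e)
    refine ⟨i, hi, ?_⟩
    rw [mem_arcHV_iff, hfi]
    by_cases hσ : σ.tri = (γ.sIn i).tri
    · exact Or.inl (Face.hv_eq_hv_iff.2 ⟨rfl, hσ⟩)
    · exact Or.inr (Face.hv_eq_hv_iff.2 ⟨rfl, bool_eq_of_ne_of_ne hσ htri⟩)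
  · -- two arcs in `f` sit on four distinct sides, hence (if both corner) at the two triangles
    obtain ⟨i, j, hij, hj, hfi, hfj⟩ := γ.exists_two_arcs_of_two_le_length_kindsIn h2
    have hi : i < γ.arcs.length := by omega
    obtain ⟨-, d1, d2, d3, d4⟩ := not_straight_of_two_arcs hi hj (by omega) (hfj.trans hfi.symm)
    by_cases hti : (γ.sIn i).tri = (γ.sOut i).tri
    · by_cases htj : (γ.sIn j).tri = (γ.sOut j).tri
      · -- both corner arcs: different triangles
        have hne := Side.tri_four (side_sIn hi).2.2 (side_sIn hj).2.2 d1 d2 d3 d4 hti htj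
        by_cases hσ : σ.tri = (γ.sIn i).tri
        · exact ⟨i, hi, by rw [mem_arcHV_iff, hfi]; exact Or.inl (Face.hv_eq_hv_iff.2 ⟨rfl, hσ⟩)⟩
        · exact ⟨j, hj, by rw [mem_arcHV_iff, hfj]; exact Or.inl (Face.hv_eq_hv_iff.2 ⟨rfl, bool_eq_of_ne_of_ne hσ hne⟩)⟩
      · refine ⟨j, hj, ?_⟩
        rw [mem_arcHV_iff, hfj]
        by_cases hσ : σ.tri = (γ.sIn j).tri
        · exact Or.inl (Face.hv_eq_hv_iff.2 ⟨rfl, hσ⟩)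
        · exact Or.inr (Face.hv_eq_hv_iff.2 ⟨rfl, bool_eq_of_ne_of_ne hσ htj⟩)
    · refine ⟨i, hi, ?_⟩
      rw [mem_arcHV_iff, hfi]
      by_cases hσ : σ.tri = (γ.sIn i).tri
      · exact Or.inl (Face.hv_eq_hv_iff.2 ⟨rfl, hσ⟩)
      · exact Or.inr (Face.hv_eq_hv_iff.2 ⟨rfl, bool_eq_of_ne_of_ne hσ hti⟩)

/-- The arcs of a nontrivial walk: those of the walk without its last arc, then the last one.
[folklore] [cite: GlazmanManolescu2019, §1 (definition of the model)] -/
theorem arcs_eq_dropLast_arcs_append (γ : YBWalk D a z) (hn : 0 < γ.arcs.length) :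
    γ.arcs = (γ.dropLast hn).arcs ++ [(γ.nth (γ.arcs.length - 1), z)] := by
  rw [dropLast_arcs]
  conv_lhs => rw [← List.take_append_drop (γ.arcs.length - 1) γ.arcs]
  congr 1
  rw [List.drop_eq_getElem_cons (by omega), List.drop_eq_nil_of_le (by omega), γ.arcs_getElem_eq_nth (by omega),
    show γ.arcs.length - 1 + 1 = γ.arcs.length by omega, nth_length]

/-- ★★ **THE WEIGHT CRITERION AT `θ = π/3`**: a Yang–Baxter walk whose honeycomb walk is self-avoiding has
nonzero weight (converse of the tree's `nodup_hvUpTo`: the weight vanishes exactly on the walks through a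
rhombus with two `u₂`-arcs, i.e. whose triangle list repeats a triangle). [cite: GlazmanManolescu2019, §1 («if θ = π/3, then w₂ = 0 … Thus, any rhombus may be partitioned into two equilateral triangles, whose intersections with any walk is either void or one arc»)] -/
theorem weight_pi_div_three_ne_zero_of_nodup :
    ∀ (n : ℕ) {z : MidEdge} (γ : YBWalk D a z), γ.arcs.length = n → γ.hvInner.Nodup →
      γ.weight (fun _ => π / 3) ≠ 0 := by
  intro n
  induction n with
  | zero =>
    intro z γ h0 _
    have : γ.facesVisited = ∅ := by
      rw [facesVisited, List.eq_nil_of_length_eq_zero h0]; rfl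
    rw [weight, this, Finset.prod_empty]; exact one_ne_zero
  | succ n ih =>
    intro z γ hn hnd
    have hpos : 0 < γ.arcs.length := by omega
    -- split off the last arc
    set γ₀ := γ.dropLast hpos with hγ₀
    have hlen₀ : γ₀.arcs.length = n := by rw [hγ₀, dropLast_length]; omega
    have harcs : γ.arcs = γ₀.arcs ++ [(γ.nth (γ.arcs.length - 1), z)] := γ.arcs_eq_dropLast_arcs_append hpos
    -- the last arc is `s → t` in `f`
    set f := γ.fc (γ.arcs.length - 1) with hf
    set s := γ.sIn (γ.arcs.length - 1) with hs
    set t := γ.sOut (γ.arcs.length - 1) with ht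
    obtain ⟨h1, h2, hst⟩ := side_sIn (γ := γ) (i := γ.arcs.length - 1) (by omega)
    have hz0 : f.side s = γ.nth (γ.arcs.length - 1) := by rw [hf, hs, h1, nth_eq_getElem]
    have hzz : f.side t = z := by
      rw [hf, ht, h2]
      simp only [show γ.arcs.length - 1 + 1 = γ.mids.length - 1 by have := γ.length_arcs; omega,
        γ.getElem_length_sub_one]
    have hface : arcFace (γ.nth (γ.arcs.length - 1), z) = some f := by
      rw [← hz0, ← hzz]; exact arcFace_side_side f s t hst
    -- triangles: old ones and the new arc's, disjoint
    have hinner : γ.hvInner = γ₀.hvInner ++ γ.arcHV γ₀.arcs.length := hvInner_of_arcs_snoc harcs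
    rw [hinner] at hnd
    obtain ⟨hnd₀, -, hdisj⟩ := List.nodup_append.1 hnd
    have hw₀ : γ₀.weight (fun _ => π / 3) ≠ 0 := ih γ₀ hlen₀ hnd₀
    have hn1 : γ₀.arcs.length = γ.arcs.length - 1 := by omega
    have hmem_new : f.hv s ∈ γ.arcHV γ₀.arcs.length := by
      rw [mem_arcHV_iff, hn1]; exact Or.inl rfl
    -- the local weight of `f`
    rw [γ₀.weight_eq_extWeight_mul (fun _ => π / 3) f] at hw₀
    have hext : γ₀.extWeight (fun _ => π / 3) f ≠ 0 := left_ne_zero_of_mul hw₀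
    have hloc₀ : localWeight (π / 3) (γ₀.kindsIn f) ≠ 0 := right_ne_zero_of_mul hw₀
    rw [γ.weight_eq_extWeight_mul (fun _ => π / 3) f, extWeight_of_snoc γ₀ γ f harcs hface,
      kindsIn_of_snoc γ₀ γ f harcs hface]
    refine mul_ne_zero hext ?_
    have hkind : [arcKindOf (γ.nth (γ.arcs.length - 1), z)].reduceOption = [arcKind s t] := by
      rw [← hz0, ← hzz]
      simp [arcKindOf, arcFace_side_side f s t hst, Face.sideOf_side, List.reduceOption]
    rw [hkind]
    -- if `f` was already visited, one of its triangles is on the old walk, so the new arc is a one-triangle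
    -- (corner) arc, and the old arc in `f` was a single corner arc at the other triangle
    rcases shape_of_localWeight_pi_div_three_ne_zero hloc₀ with h0 | ⟨κ, hκ, h1⟩ | h2
    · rw [h0, List.nil_append]
      exact localWeight_pi_div_three_single_ne_zero (arcKind_ne_degen hst)
    · rw [h1, List.singleton_append]
      by_cases hκc : κ = .corner
      · subst hκc
        -- the old corner arc's triangle is on the old walk; the new arc must avoid it: it is a corner arc too
        obtain ⟨i₀, hi₀, hfi₀, -⟩ := γ₀.exists_arc_of_mem_kindsIn (f := f) (κ := .corner) (by rw [h1]; simp)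
        have hT₀ : f.hv (γ₀.sIn i₀) ∈ γ₀.hvInner := by
          rw [hvInner, mem_hvUpTo_iff]; exact ⟨i₀, hi₀, by rw [mem_arcHV_iff, hfi₀]; exact Or.inl rfl⟩
        have hst' : s.tri = t.tri := by
          by_contra hne
          apply hdisj _ hT₀ (f.hv (γ₀.sIn i₀)) ?_ rfl
          rw [mem_arcHV_iff, hn1]
          by_cases hσ : (γ₀.sIn i₀).tri = s.tri
          · exact Or.inl (Face.hv_eq_hv_iff.2 ⟨rfl, hσ⟩)
          · exact Or.inr (Face.hv_eq_hv_iff.2 ⟨rfl, bool_eq_of_ne_of_ne hσ hne⟩)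
        rw [(arcKind_eq_corner_iff hst).2 hst']
        exact localWeight_pi_div_three_corner_corner_ne_zero
      · exfalso
        have hT : f.hv s ∈ γ₀.hvInner := γ₀.hv_mem_hvInner_of_kindsIn (Or.inl ⟨κ, hκc, by rw [h1]; simp⟩) s
        exact hdisj _ hT _ hmem_new rfl
    · exfalso
      have hT : f.hv s ∈ γ₀.hvInner := γ₀.hv_mem_hvInner_of_kindsIn (Or.inr (by rw [h2]; simp)) s
      exact hdisj _ hT _ hmem_new rfl

/-- ★★ **THE WEIGHT CRITERION, iff form**: at `θ = π/3` a Yang–Baxter walk has nonzero weight iff its honeycomb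
walk visits distinct triangles. [cite: GlazmanManolescu2019, §1 (Fig. 2)] -/
theorem weight_pi_div_three_ne_zero_iff_nodup (γ : YBWalk D a z) :
    γ.weight (fun _ => π / 3) ≠ 0 ↔ γ.hvInner.Nodup :=
  ⟨fun h => nodup_hvUpTo h le_rfl, fun h => weight_pi_div_three_ne_zero_of_nodup _ γ rfl h⟩

end YBWalk

/-! ## §11. The observable identity: at `θ = π/3` Glazman–Manolescu's parafermionic observable of a
rhombic domain IS Duminil-Copin–Smirnov's honeycomb observable of its triangle domain (edition 3) -/

section Observable

open HV

/-- **DCS's observable at a rhombus side, in the tree's honeycomb vocabulary**: the sum of the parafermionic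
weights `x_c^ℓ λ^{pturn}` of the self-avoiding mid-edge walks of `V` from `a = {w, O}` whose final half-edge
crosses the rhombus side `z` (from either bordering triangle). [cite: DuminilCopinSmirnov2012, Definition 1 (F(z) = Σ_{γ ⊂ Ω : a → z} e^{−iσW_γ(a,z)} x^{ℓ(γ)})] -/
def hexObservableAt (V : Finset HV) (z : MidEdge) : ℂ :=
  ∑ P ∈ (midWalks V).filter (fun P => edgeOf (finalDart P).1 (finalDart P).2 = some z), pwt P

/-- A walk of zero weight has zero parafermionic weight. [cite: GlazmanManolescu2019, eq. (2.1)] -/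
theorem YBWalk.paraWeight_eq_zero_of_weight_eq_zero {D : Set Face} {a z : MidEdge} (γ : YBWalk D a z)
    {Θ : ℤ → ℝ} (h : γ.weight Θ = 0) : γ.paraWeight Θ = 0 := by
  rw [YBWalk.paraWeight, h]; simp

/-- ★★★ **THE OBSERVABLE IDENTITY AT `θ = π/3`.** For every finite set of rhombi `DF` not containing `(-1,0)`
(the origin mid-edge is the `W` side of `(0,0)`) and every mid-edge `z`, Glazman–Manolescu's parafermionic
observable of the rhombic domain at `Θ ≡ π/3`, `Σ_{γ : 0 → z} w(γ) e^{−i(5/8)wind(γ)}`, EQUALS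
Duminil-Copin–Smirnov's observable of the triangle domain at the side `z`: the honeycomb walk is a
weight- and phase-preserving bijection from the Yang–Baxter walks of nonzero weight onto DCS's mid-edge
walks ending across `z` (walks of zero weight contribute nothing). [cite: GlazmanManolescu2019, §1 («The self-avoiding walk model described above becomes that on the hexagonal lattice») and §2.1, eq. (2.1)] [cite: DuminilCopinSmirnov2012, Definition 1] -/
theorem parafermionOn_pi_div_three_eq_hexObservableAt (D : Set Face) [Finite D] (DF : Finset Face)
    (hDF : ∀ f, f ∈ D ↔ f ∈ DF) (hD' : ((-1 : ℤ), (0 : ℤ)) ∉ D) (z : MidEdge) :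
    parafermionOn D origin (fun _ => π / 3) z = hexObservableAt (triSet DF) z := by
  have hV : ∀ f ∈ D, ∀ s : Side, f.hv s ∈ triSet DF := fun f hf s => hv_mem_triSet ((hDF f).1 hf) s
  unfold parafermionOn hexObservableAt
  rw [← Finset.sum_filter_of_ne (p := fun γ : YBWalk D origin z => γ.weight (fun _ => π / 3) ≠ 0)
    (fun γ _ hne hw => hne (γ.paraWeight_eq_zero_of_weight_eq_zero hw))]
  refine Finset.sum_bij (fun γ _ => γ.hvWalk) ?_ ?_ ?_ ?_
  · intro γ hγ
    rw [Finset.mem_filter] at hγ ⊢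
    exact ⟨mem_midWalks_iff.2 (γ.isMidWalk_hvWalk_of_origin hD' hV hγ.2), γ.edgeOf_finalDart_hvWalk_of_origin' hD'⟩
  · intro γ₁ _ γ₂ _ h
    apply YBWalk.ext
    rw [← γ₁.pairEdges_hvWalk_of_origin hD', ← γ₂.pairEdges_hvWalk_of_origin hD', h]
  · intro P hP
    rw [Finset.mem_filter, mem_midWalks_iff] at hP
    obtain ⟨z', γ', hγ'⟩ := YBWalk.exists_hvWalk_eq D DF hDF hD' P.length P rfl hP.1 (by rw [hP.2]; rfl)
    have hz : z' = z := by
      have h1 := γ'.edgeOf_finalDart_hvWalk_of_origin' hD'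
      rw [hγ', hP.2] at h1
      exact (Option.some_injective _ h1).symm
    subst hz
    refine ⟨γ', ?_, hγ'⟩
    rw [Finset.mem_filter]
    refine ⟨Finset.mem_univ _, (γ'.weight_pi_div_three_ne_zero_iff_nodup).2 ?_⟩
    rw [← γ'.inner_hvWalk_of_origin hD', hγ']
    exact hP.1.2.2.2.2.1
  · intro γ hγ
    rw [Finset.mem_filter] at hγ
    exact γ.paraWeight_pi_div_three hγ.2

/-- The same identity for a finite set of rhombi given as a `Finset`. [cite: GlazmanManolescu2019, §1 and §2.1] [cite: DuminilCopinSmirnov2012, Definition 1] -/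
theorem parafermionOn_coe_pi_div_three_eq_hexObservableAt (DF : Finset Face) (hD : ((-1 : ℤ), (0 : ℤ)) ∉ DF)
    (z : MidEdge) :
    parafermionOn (↑DF : Set Face) origin (fun _ => π / 3) z = hexObservableAt (triSet DF) z :=
  parafermionOn_pi_div_three_eq_hexObservableAt _ DF (fun _ => Finset.mem_coe) (fun h => hD (Finset.mem_coe.1 h)) z

end Observable

/-! ## §12. The vertex functional at `θ = π/3` is the sum of Duminil-Copin–Smirnov's two triangle
relations (edition 3) -/

section VertexFunctional

open HV Literature.Barriers.CriticalPhenomena.PlaquetteWalk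
open Literature.Barriers.CriticalPhenomena (PlaquetteWalk.dom)

/-- **The directions out of the two triangles across the four sides**, in `ℤ[ω]`: across `E`: `2ω − 1`,
across `W`: `1 − 2ω`, across `N`: `ω − 2`, across `S`: `2 − ω` — i.e. `(2ω − 1)` times Glazman–Manolescu's
contour coefficients `(1, −1, e^{iπ/3}, −e^{iπ/3})` of (CR) at `θ = π/3`. [cite: GlazmanManolescu2019, Lemma 2.1, eq. (CR)] [cite: DuminilCopinSmirnov2012, Lemma 1 («(p − v)F(p) + (q − v)F(q) + (r − v)F(r) = 0»)] -/
theorem edir_hv_hvAcross (f : Face) (s : Side) :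
    edir (f.hv s) (f.hvAcross s) = (2 * omg - 1) * crCoef (π / 3) s := by
  obtain ⟨k, j⟩ := f
  have hN : crCoef (π / 3) .N = omg := rfl
  have hS : crCoef (π / 3) .S = -omg := rfl
  cases s
  · -- W
    simp only [edir, pos, Face.hv, Face.hvAcross, Side.tri, crCoef, emb, Bool.false_eq_true, if_false, if_true,
      Prod.mk_sub_mk]
    push_cast; ring
  · -- E
    simp only [edir, pos, Face.hv, Face.hvAcross, Side.tri, crCoef, emb, Bool.false_eq_true, if_false, if_true,
      Prod.mk_sub_mk]
    push_cast; ring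
  · -- S
    rw [hS]
    simp only [edir, pos, Face.hv, Face.hvAcross, Side.tri, emb, Bool.false_eq_true, if_false, if_true, Prod.mk_sub_mk]
    push_cast
    linear_combination (2 : ℂ) * omg_sq
  · -- N
    rw [hN]
    simp only [edir, pos, Face.hv, Face.hvAcross, Side.tri, emb, Bool.false_eq_true, if_false, if_true, Prod.mk_sub_mk]
    push_cast
    linear_combination (-2 : ℂ) * omg_sq

/-- **The two triangle relations, dart by dart.** For a dart `(p, q)` of the honeycomb lattice and a rhombus `f`
with triangles `T₁ = f.hv W`, `T₂ = f.hv E`: the sum of the coefficients of `T₁` and `T₂` seen from the dart is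
the direction across `s` if the dart crosses the side `s` of `f`, and `0` otherwise (the dart along the short
diagonal contributes `(T₂ − T₁) + (T₁ − T₂) = 0`). [cite: DuminilCopinSmirnov2012, proof of Lemma 1 («c(γ)»)] -/
theorem dartCoeff_add_dartCoeff_eq (f : Face) {p q : HV} (hadj : hvGraph.Adj p q) :
    ((if p = f.hv .W then edir (f.hv .W) q else 0) + (if q = f.hv .W then edir (f.hv .W) p else 0)) +
      ((if p = f.hv .E then edir (f.hv .E) q else 0) + (if q = f.hv .E then edir (f.hv .E) p else 0)) =
      ∑ s : Side, if edgeOf p q = some (f.side s) then edir (f.hv s) (f.hvAcross s) else 0 := by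
  have hWN : f.hv .N = f.hv .W := Face.hv_eq_hv_iff.2 ⟨rfl, rfl⟩
  have hSE : f.hv .S = f.hv .E := Face.hv_eq_hv_iff.2 ⟨rfl, rfl⟩
  have hWE : f.hv .W ≠ f.hv .E := fun h => by have := (Face.hv_eq_hv_iff.1 h).2; exact absurd this (by decide)
  -- the four-term sum on the right, evaluated
  have hsum : ∀ (t : Side), edgeOf p q = some (f.side t) →
      (∑ s : Side, if edgeOf p q = some (f.side s) then edir (f.hv s) (f.hvAcross s) else 0) =
        edir (f.hv t) (f.hvAcross t) := by
    intro t ht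
    rw [Finset.sum_eq_single t]
    · rw [if_pos ht]
    · intro s _ hst
      rw [if_neg]
      rw [ht, Option.some.injEq]
      exact fun h => hst (f.side_injective h).symm
    · intro h; exact absurd (Finset.mem_univ t) h
  by_cases hex : ∃ t : Side, edgeOf p q = some (f.side t)
  · obtain ⟨t, ht⟩ := hex
    rw [hsum t ht]
    have hA1 : f.hvAcross t ≠ f.hv .W := Face.hvAcross_ne_hv f t .W
    have hA2 : f.hvAcross t ≠ f.hv .E := Face.hvAcross_ne_hv f t .E
    rcases edgeOf_eq_some_side ht with ⟨rfl, rfl⟩ | ⟨rfl, rfl⟩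
    · -- leaving `f` through `t`
      cases t
      · simp [hA1, hA2, hWE]
      · simp [hA1, hA2, hWE.symm]
      · rw [hSE]; simp [hA1, hA2, hWE.symm]
      · rw [hWN]; simp [hA1, hA2, hWE]
    · -- entering `f` through `t`
      cases t
      · simp [hA1, hA2, hWE]
      · simp [hA1, hA2, hWE.symm]
      · rw [hSE]; simp [hA1, hA2, hWE.symm]
      · rw [hWN]; simp [hA1, hA2, hWE]
  · push Not at hex
    rw [Finset.sum_eq_zero (fun s _ => if_neg (hex s))]
    -- the dart touches `T₁` or `T₂` only along the short diagonal
    have key : ∀ (τ : Side), p = f.hv τ → q = f.hv τ.opp := by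
      intro τ hpτ
      rw [hpτ] at hadj
      rcases adj_hv_cases hadj with ⟨τ', hτ', hq'⟩ | ⟨t, ht, hq'⟩
      · rw [hq']; exact Face.hv_eq_hv_iff.2 ⟨rfl, by revert hτ'; cases τ <;> cases τ' <;> decide⟩
      · exfalso
        rw [Face.hv_eq_hv_iff.2 ⟨rfl, ht.symm⟩] at hpτ
        exact hex t (by rw [hpτ, hq', edgeOf_hv_hvAcross])
    have key' : ∀ (τ : Side), q = f.hv τ → p = f.hv τ.opp := by
      intro τ hqτ
      rw [hqτ] at hadj
      rcases adj_hv_cases hadj.symm with ⟨τ', hτ', hp'⟩ | ⟨t, ht, hp'⟩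
      · rw [hp']; exact Face.hv_eq_hv_iff.2 ⟨rfl, by revert hτ'; cases τ <;> cases τ' <;> decide⟩
      · exfalso
        rw [Face.hv_eq_hv_iff.2 ⟨rfl, ht.symm⟩] at hqτ
        exact hex t (by rw [hqτ, hp', edgeOf_hvAcross_hv])
    by_cases h1 : p = f.hv .W
    · have h2 : q = f.hv .E := (key .W h1).trans rfl
      simp [h1, h2, hWE, hWE.symm, edir_rev (f.hv .W) (f.hv .E)]
    · by_cases h2 : p = f.hv .E
      · have h3 : q = f.hv .W := (key .E h2).trans rfl
        simp [h2, h3, hWE, hWE.symm, edir_rev (f.hv .W) (f.hv .E)]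
      · by_cases h3 : q = f.hv .W
        · exact absurd ((key' .W h3).trans rfl) h2
        · by_cases h4 : q = f.hv .E
          · exact absurd ((key' .E h4).trans rfl) h1
          · simp [h1, h2, h3, h4]

/-- **The two triangle relations, walk by walk**: `c_{T₁}(γ) + c_{T₂}(γ)` is `(direction across s)·x_c^ℓ λ^{pturn}`
if the final half-edge of `γ` crosses the side `s` of `f`, else `0`. [cite: DuminilCopinSmirnov2012, proof of Lemma 1 («c(γ)»)] -/
theorem cv_add_cv_eq (f : Face) {P : List HV} (hadj : hvGraph.Adj (finalDart P).1 (finalDart P).2) :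
    cv (f.hv .W) P + cv (f.hv .E) P =
      (∑ s : Side, if edgeOf (finalDart P).1 (finalDart P).2 = some (f.side s)
        then edir (f.hv s) (f.hvAcross s) else 0) * pwt P := by
  rw [cv, cv, ← add_mul, dartCoeff_add_dartCoeff_eq f hadj]

/-- ★★ **The two triangle relations summed over all walks**: for every honeycomb vertex set `V` and rhombus
`f`, `Σ_γ (c_{T₁}(γ) + c_{T₂}(γ)) = Σ_s (direction across s)·F_hex(f.side s)` — the left-hand sides of
Duminil-Copin–Smirnov's relations at the two triangles of `f` add up to a combination of the observable at
the four SIDES of `f` only (the short diagonal cancels). [cite: DuminilCopinSmirnov2012, Lemma 1 and its proof] -/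
theorem sum_cv_add_cv_eq (V : Finset HV) (f : Face) :
    ∑ P ∈ midWalks V, (cv (f.hv .W) P + cv (f.hv .E) P) =
      ∑ s : Side, edir (f.hv s) (f.hvAcross s) * hexObservableAt V (f.side s) := by
  have h1 : ∀ P ∈ midWalks V, cv (f.hv .W) P + cv (f.hv .E) P =
      ∑ s : Side, (if edgeOf (finalDart P).1 (finalDart P).2 = some (f.side s) then edir (f.hv s) (f.hvAcross s) else 0) * pwt P := by
    intro P hP
    rw [cv_add_cv_eq f (mem_midWalks_iff.1 hP).adj_finalDart, Finset.sum_mul]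
  rw [Finset.sum_congr rfl h1, Finset.sum_comm]
  refine Finset.sum_congr rfl fun s _ => ?_
  rw [hexObservableAt, Finset.mul_sum, Finset.sum_filter]
  refine Finset.sum_congr rfl fun P _ => ?_
  split_ifs <;> simp

/-- ★★★ **THE VERTEX FUNCTIONAL AT `θ = π/3` IS THE SUM OF THE TWO TRIANGLE RELATIONS.** For every finite list
of rhombi `Dl` not containing `(-1, 0)`, rooted at the origin (the `W` side of `(0,0)`), and EVERY rhombus `f`
(triangles `T₁ = f.hv W`, `T₂ = f.hv E`): `(2ω − 1) · VF_{Dl}(0; f) = Σ_{γ} (c_{T₁}(γ) + c_{T₂}(γ))`, the sum over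
Duminil-Copin–Smirnov's mid-edge walks of the triangle domain of the left-hand sides of the relations at `T₁`
and at `T₂` (`2ω − 1 = i√3 ≠ 0`). Consequently the Yang–Baxter defect of a hole root at `π/3` is carried by the
DCS defects of the two triangles (the lane's `HexSAWVertexRelationHoleRoot.sum_cv_eq_sum_encircling`: by the
encircling loop walks). [cite: GlazmanManolescu2019, §1 (θ = π/3) and Lemma 2.1] [cite: DuminilCopinSmirnov2012, Lemma 1] -/
theorem vertexFunctional_printed_pi_div_three_eq_sum_cv (Dl : List Face) (hD : ((-1 : ℤ), (0 : ℤ)) ∉ Dl)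
    (f : Face) :
    (2 * omg - 1) * vertexFunctional (printedWeights (π / 3)) tFiveEighths (ybCoeff (π / 3)) Dl origin f =
      ∑ P ∈ midWalks (triSet Dl.toFinset), (cv (f.hv .W) P + cv (f.hv .E) P) := by
  have hD' : ((-1 : ℤ), (0 : ℤ)) ∉ PlaquetteWalk.dom Dl := hD
  have hF : ∀ z, parafermionOn (PlaquetteWalk.dom Dl) origin (fun _ => π / 3) z = hexObservableAt (triSet Dl.toFinset) z :=
    fun z => parafermionOn_pi_div_three_eq_hexObservableAt (PlaquetteWalk.dom Dl) Dl.toFinset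
      (fun g => by simp [PlaquetteWalk.dom]) hD' z
  rw [vertexFunctional_printed_eq_phase_mul_lem21Defect, sum_cv_add_cv_eq, hF, hF, hF, hF]
  have h0 : slantPot (fun _ : ℤ => π / 3) origin = 0 := rfl
  rw [h0]
  have hu : (Finset.univ : Finset Side) = {Side.W, Side.E, Side.S, Side.N} := by decide
  rw [hu, Finset.sum_insert (by decide), Finset.sum_insert (by decide), Finset.sum_insert (by decide),
    Finset.sum_singleton]
  simp only [edir_hv_hvAcross, crCoef]
  have e : Complex.exp (((-(5 / 8 * (0 : ℝ)) : ℝ) : ℂ) * Complex.I) = 1 := by simp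
  rw [e, one_mul]
  have hω : Complex.exp (((π / 3 : ℝ) : ℂ) * Complex.I) = omg := rfl
  rw [hω]
  ring

/-- `2ω − 1 = i√3` is nonzero (so the identity above determines the vertex functional).
[folklore] [cite: DuminilCopinSmirnov2012, Lemma 1] -/
theorem two_mul_omg_sub_one_ne_zero : 2 * omg - 1 ≠ 0 := by
  intro h
  have h1 : omg = 1 / 2 := by linear_combination h / 2
  have h2 := omg_sq
  rw [h1] at h2
  norm_num at h2

end VertexFunctional

/-! ## §13. Translations: the dictionary at every `W`-rooted position (edition 4) -/

section Shift

/-- Translation of faces by a lattice vector. [folklore] [cite: GlazmanManolescu2019, §4.2 (translation invariance)] -/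
def Face.shiftBy (v : ℤ × ℤ) (f : Face) : Face := (f.1 + v.1, f.2 + v.2)

/-- Translation of mid-edges by a lattice vector. [folklore] [cite: GlazmanManolescu2019, §4.2 (translation invariance)] -/
def MidEdge.shiftBy (v : ℤ × ℤ) : MidEdge → MidEdge
  | .vert k j => .vert (k + v.1) (j + v.2)
  | .slant k j => .slant (k + v.1) (j + v.2)

/-- Translating back. [folklore] [cite: GlazmanManolescu2019, §4.2 (translation invariance)] -/
@[simp] theorem Face.shiftBy_shiftBy_neg (v : ℤ × ℤ) (f : Face) : Face.shiftBy (-v) (Face.shiftBy v f) = f := by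
  unfold Face.shiftBy; ext <;> simp

/-- Translating forth. [folklore] [cite: GlazmanManolescu2019, §4.2 (translation invariance)] -/
@[simp] theorem Face.shiftBy_neg_shiftBy (v : ℤ × ℤ) (f : Face) : Face.shiftBy v (Face.shiftBy (-v) f) = f := by
  unfold Face.shiftBy; ext <;> simp

/-- Translation of faces is injective. [folklore] [cite: GlazmanManolescu2019, §4.2 (translation invariance)] -/
theorem Face.shiftBy_injective (v : ℤ × ℤ) : Function.Injective (Face.shiftBy v) := fun f g h => by
  rw [← Face.shiftBy_shiftBy_neg v f, h, Face.shiftBy_shiftBy_neg]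

/-- Translating back. [folklore] [cite: GlazmanManolescu2019, §4.2 (translation invariance)] -/
@[simp] theorem MidEdge.shiftBy_shiftBy_neg (v : ℤ × ℤ) (e : MidEdge) : (e.shiftBy v).shiftBy (-v) = e := by
  cases e <;> simp [MidEdge.shiftBy]

/-- Translating forth. [folklore] [cite: GlazmanManolescu2019, §4.2 (translation invariance)] -/
@[simp] theorem MidEdge.shiftBy_neg_shiftBy (v : ℤ × ℤ) (e : MidEdge) : (e.shiftBy (-v)).shiftBy v = e := by
  cases e <;> simp [MidEdge.shiftBy]

/-- Translation of mid-edges is injective. [folklore] [cite: GlazmanManolescu2019, §4.2 (translation invariance)] -/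
theorem MidEdge.shiftBy_injective (v : ℤ × ℤ) : Function.Injective (MidEdge.shiftBy v) := fun e e' h => by
  rw [← MidEdge.shiftBy_shiftBy_neg v e, h, MidEdge.shiftBy_shiftBy_neg]

/-- Translation commutes with "the two faces bordering a mid-edge". [folklore] [cite: GlazmanManolescu2019, §4.2 (translation invariance)] -/
theorem MidEdge.faces_shiftBy (v : ℤ × ℤ) (e : MidEdge) :
    (e.shiftBy v).faces = (Face.shiftBy v e.faces.1, Face.shiftBy v e.faces.2) := by
  cases e with
  | vert k j => simp only [MidEdge.shiftBy, MidEdge.faces, Face.shiftBy, Prod.mk.injEq, and_true]; ring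
  | slant k j => simp only [MidEdge.shiftBy, MidEdge.faces, Face.shiftBy, Prod.mk.injEq, true_and, and_true]; ring

/-- Translation commutes with "the common face of two mid-edges". [folklore] [cite: GlazmanManolescu2019, §4.2 (translation invariance)] -/
theorem MidEdge.commonFace_shiftBy (v : ℤ × ℤ) (e e' : MidEdge) :
    commonFace (e.shiftBy v) (e'.shiftBy v) = (commonFace e e').map (Face.shiftBy v) := by
  unfold commonFace
  simp only [(MidEdge.shiftBy_injective v).eq_iff, MidEdge.faces_shiftBy, (Face.shiftBy_injective v).eq_iff]
  split_ifs <;> simp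

/-- Translation preserves "which side of a face a mid-edge is". [folklore] [cite: GlazmanManolescu2019, §4.2 (translation invariance)] -/
theorem Face.sideOf_shiftBy (v : ℤ × ℤ) (f : Face) (e : MidEdge) :
    Face.sideOf (Face.shiftBy v f) (e.shiftBy v) = f.sideOf e := by
  have h1 : ∀ j : ℤ, j + v.2 = f.2 + v.2 + 1 ↔ j = f.2 + 1 := fun j => by omega
  have h2 : ∀ k : ℤ, k + v.1 = f.1 + v.1 + 1 ↔ k = f.1 + 1 := fun k => by omega
  cases e <;> simp [Face.sideOf, MidEdge.shiftBy, Face.shiftBy, h1, h2]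

/-- Translation commutes with "the mid-edge on a given side of a face". [folklore] [cite: GlazmanManolescu2019, §4.2 (translation invariance)] -/
theorem Face.side_shiftBy (v : ℤ × ℤ) (f : Face) (s : Side) :
    (Face.shiftBy v f).side s = (f.side s).shiftBy v := by
  cases s <;> (simp [Face.side, MidEdge.shiftBy, Face.shiftBy]; try ring)

/-- Translation commutes with "the face of an arc". [folklore] [cite: GlazmanManolescu2019, §4.2 (translation invariance)] -/
theorem arcFace_shiftBy (v : ℤ × ℤ) (p : MidEdge × MidEdge) :
    arcFace (Prod.map (MidEdge.shiftBy v) (MidEdge.shiftBy v) p) = (arcFace p).map (Face.shiftBy v) :=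
  MidEdge.commonFace_shiftBy v p.1 p.2

/-- Translation preserves the kind of an arc. [folklore] [cite: GlazmanManolescu2019, §4.2 (translation invariance)] -/
theorem arcKindOf_shiftBy (v : ℤ × ℤ) (p : MidEdge × MidEdge) :
    arcKindOf (Prod.map (MidEdge.shiftBy v) (MidEdge.shiftBy v) p) = arcKindOf p := by
  unfold arcKindOf
  rw [arcFace_shiftBy]
  cases arcFace p with
  | none => rfl
  | some f => simp [Face.sideOf_shiftBy]

/-- Translation preserves the rotation of an arc at constant angle. [cite: GlazmanManolescu2019, §2.1 (wind(γ))] -/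
theorem arcTurnOf_shiftBy (v : ℤ × ℤ) (θ : ℝ) (p : MidEdge × MidEdge) :
    arcTurnOf (fun _ => θ) (Prod.map (MidEdge.shiftBy v) (MidEdge.shiftBy v) p) = arcTurnOf (fun _ => θ) p := by
  unfold arcTurnOf
  rw [arcFace_shiftBy]
  cases arcFace p with
  | none => rfl
  | some f => simp [Face.sideOf_shiftBy]

namespace YBWalk

variable {D : Set Face} {a z : MidEdge}

/-- **Translation of a walk** by a lattice vector (its domain is translated along).
[cite: GlazmanManolescu2019, §4.2 ("the invariance G_Θ(a,b) = G_Θ(0,b−a)")] -/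
def shiftBy (v : ℤ × ℤ) (γ : YBWalk D a z) :
    YBWalk (Face.shiftBy (-v) ⁻¹' D) (a.shiftBy v) (z.shiftBy v) where
  mids := γ.mids.map (MidEdge.shiftBy v)
  head_eq := by rw [List.head?_map, γ.head_eq]; rfl
  getLast_eq := by rw [List.getLast?_map, γ.getLast_eq]; rfl
  nodup := γ.nodup.map (MidEdge.shiftBy_injective v)
  arc_mem p hp := by
    rw [arcsOf_map, List.mem_map] at hp
    obtain ⟨q, hq, rfl⟩ := hp
    obtain ⟨f, hfD, hqf⟩ := γ.arc_mem q hq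
    refine ⟨Face.shiftBy v f, ?_, ?_⟩
    · simpa using hfD
    · rw [arcFace_shiftBy, hqf]; rfl
  isChain := by
    rw [arcsOf_map]
    refine List.isChain_map_of_isChain _ (fun p q h => ?_) γ.isChain
    rw [arcFace_shiftBy, arcFace_shiftBy]
    exact fun h' => h (Option.map_injective (Face.shiftBy_injective v) h')
  noncross f := by
    have key : ∀ (g : Face) (s t : Side), ((Face.shiftBy v g).side s, (Face.shiftBy v g).side t) ∈
        arcsOf (γ.mids.map (MidEdge.shiftBy v)) ↔ (g.side s, g.side t) ∈ arcsOf γ.mids := by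
      intro g s t
      rw [arcsOf_map, Face.side_shiftBy, Face.side_shiftBy]
      exact List.mem_map_of_injective (a := (g.side s, g.side t))
        ((MidEdge.shiftBy_injective v).prodMap (MidEdge.shiftBy_injective v))
    have := γ.noncross (Face.shiftBy (-v) f)
    simpa only [← key (Face.shiftBy (-v) f), Face.shiftBy_neg_shiftBy] using this

/-- The mid-edges of a translated walk. [folklore] [cite: GlazmanManolescu2019, §4.2 (translation invariance)] -/
@[simp] theorem mids_shiftBy (v : ℤ × ℤ) (γ : YBWalk D a z) :
    (γ.shiftBy v).mids = γ.mids.map (MidEdge.shiftBy v) := rfl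

/-- The faces visited by a translated walk. [folklore] [cite: GlazmanManolescu2019, §4.2 (translation invariance)] -/
theorem facesVisited_shiftBy (v : ℤ × ℤ) (γ : YBWalk D a z) :
    (γ.shiftBy v).facesVisited = γ.facesVisited.map ⟨_, Face.shiftBy_injective v⟩ := by
  unfold facesVisited arcs
  rw [mids_shiftBy, arcsOf_map, List.filterMap_map]
  ext f
  simp only [List.mem_toFinset, List.mem_filterMap, Function.comp_apply, arcFace_shiftBy,
    Option.map_eq_some_iff, Finset.mem_map, Function.Embedding.coeFn_mk]
  grind

/-- The arcs of a translated walk in a translated face. [folklore] [cite: GlazmanManolescu2019, §4.2 (translation invariance)] -/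
theorem kindsIn_shiftBy (v : ℤ × ℤ) (γ : YBWalk D a z) (f : Face) :
    (γ.shiftBy v).kindsIn (Face.shiftBy v f) = γ.kindsIn f := by
  unfold kindsIn arcs
  rw [mids_shiftBy, arcsOf_map, List.filterMap_map]
  congr 1
  funext p
  simp only [Function.comp_apply, arcFace_shiftBy, arcKindOf_shiftBy]
  rcases h : arcFace p with _ | g
  · simp
  · simp [(Face.shiftBy_injective v).eq_iff]

/-- **Translation invariance of the weight at constant angle.** [cite: GlazmanManolescu2019, §4.2] -/
theorem weight_shiftBy (v : ℤ × ℤ) (θ : ℝ) (γ : YBWalk D a z) :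
    (γ.shiftBy v).weight (fun _ => θ) = γ.weight (fun _ => θ) := by
  unfold weight
  rw [facesVisited_shiftBy, Finset.prod_map]
  refine Finset.prod_congr rfl fun f _ => ?_
  simp [kindsIn_shiftBy]

/-- **Translation invariance of the winding at constant angle.** [cite: GlazmanManolescu2019, §2.1] -/
theorem winding_shiftBy (v : ℤ × ℤ) (θ : ℝ) (γ : YBWalk D a z) :
    (γ.shiftBy v).winding (fun _ => θ) = γ.winding (fun _ => θ) := by
  rw [winding_eq_map_sum, winding_eq_map_sum]
  unfold arcs
  rw [mids_shiftBy, arcsOf_map, List.map_map]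
  congr 1
  refine List.map_congr_left fun p _ => ?_
  exact arcTurnOf_shiftBy v θ p

/-- Translation invariance of the parafermionic weight at constant angle. [cite: GlazmanManolescu2019, §2.1, §4.2] -/
theorem paraWeight_shiftBy (v : ℤ × ℤ) (θ : ℝ) (γ : YBWalk D a z) :
    (γ.shiftBy v).paraWeight (fun _ => θ) = γ.paraWeight (fun _ => θ) := by
  rw [paraWeight, paraWeight, weight_shiftBy, winding_shiftBy]

/-- Transport of a walk along equalities of domain and endpoints. [folklore] [cite: GlazmanManolescu2019, §4.2 (translation invariance)] -/
def castAll {D D' : Set Face} {a a' z z' : MidEdge} (γ : YBWalk D a z) (hD : D = D') (ha : a = a') (hz : z = z') :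
    YBWalk D' a' z' where
  mids := γ.mids
  head_eq := ha ▸ γ.head_eq
  getLast_eq := hz ▸ γ.getLast_eq
  nodup := γ.nodup
  arc_mem := hD ▸ γ.arc_mem
  isChain := γ.isChain
  noncross := γ.noncross

/-- `castAll` keeps the mid-edges. [folklore] [cite: GlazmanManolescu2019, §4.2 (translation invariance)] -/
@[simp] theorem mids_castAll {D D' : Set Face} {a a' z z' : MidEdge} (γ : YBWalk D a z) (hD : D = D')
    (ha : a = a') (hz : z = z') : (γ.castAll hD ha hz).mids = γ.mids := rfl

/-- Translating twice by opposite vectors is the identity on domains. [folklore] [cite: GlazmanManolescu2019, §4.2 (translation invariance)] -/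
theorem preimage_shiftBy_shiftBy (v : ℤ × ℤ) (D : Set Face) :
    Face.shiftBy (- -v) ⁻¹' (Face.shiftBy (-v) ⁻¹' D) = D := by
  ext f; simp

/-- **Translation is a bijection of walks** (inverse: translating back).
[cite: GlazmanManolescu2019, §4.2] -/
def shiftByEquiv (v : ℤ × ℤ) (D : Set Face) (a z : MidEdge) :
    YBWalk D a z ≃ YBWalk (Face.shiftBy (-v) ⁻¹' D) (a.shiftBy v) (z.shiftBy v) where
  toFun γ := γ.shiftBy v
  invFun δ := (δ.shiftBy (-v)).castAll (preimage_shiftBy_shiftBy v D) (by simp) (by simp)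
  left_inv γ := by
    apply YBWalk.ext
    simp [List.map_map, Function.comp_def]
  right_inv δ := by
    apply YBWalk.ext
    simp [List.map_map, Function.comp_def]

/-- ★ **Translation invariance of the parafermionic observable at constant angle**: translating the
domain, the root and the endpoint together does not change `F`. [cite: GlazmanManolescu2019, §4.2 ("the invariance G_Θ(a,b) = G_Θ(0,b−a)")] -/
theorem parafermionOn_shiftBy (v : ℤ × ℤ) (D : Set Face) [Finite D] [Finite (Face.shiftBy (-v) ⁻¹' D)]
    (a z : MidEdge) (θ : ℝ) :
    parafermionOn (Face.shiftBy (-v) ⁻¹' D) (a.shiftBy v) (fun _ => θ) (z.shiftBy v) = parafermionOn D a (fun _ => θ) z := by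
  unfold parafermionOn
  rw [← Equiv.sum_comp (shiftByEquiv v D a z)]
  exact Finset.sum_congr rfl fun γ _ => paraWeight_shiftBy v θ γ

end YBWalk

end Shift

/-! ## §14. The dictionary at every `W`-rooted rhombus (edition 4) -/

section GeneralRoot

open HV Literature.Barriers.CriticalPhenomena.PlaquetteWalk
open Literature.Barriers.CriticalPhenomena (PlaquetteWalk.dom)

/-- The face domain of a translated list is the translated domain. [folklore] [cite: GlazmanManolescu2019, §4.2 (translation invariance)] -/
theorem dom_map_shiftBy (v : ℤ × ℤ) (Dl : List Face) :
    PlaquetteWalk.dom (Dl.map (Face.shiftBy v)) = Face.shiftBy (-v) ⁻¹' PlaquetteWalk.dom Dl := by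
  ext f
  simp only [PlaquetteWalk.dom, Set.mem_setOf_eq, List.mem_map, Set.mem_preimage]
  constructor
  · rintro ⟨g, hg, rfl⟩; simpa using hg
  · intro h; exact ⟨_, h, by simp⟩

/-- The observable depends on the domain only as a set (the finiteness witnesses are irrelevant). [folklore] [cite: GlazmanManolescu2019, §4.2 (translation invariance)] -/
theorem parafermionOn_congr {D D' : Set Face} [Finite D] [Finite D'] (h : D = D') (a : MidEdge) (Θ : ℤ → ℝ)
    (z : MidEdge) : parafermionOn D a Θ z = parafermionOn D' a Θ z := by
  subst h; rfl

/-- The slant potential is translation invariant at constant angle. [cite: GlazmanManolescu2019, §2.1] -/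
theorem slantPot_shiftBy (v : ℤ × ℤ) (θ : ℝ) (e : MidEdge) :
    slantPot (fun _ => θ) (e.shiftBy v) = slantPot (fun _ => θ) e := by
  cases e <;> rfl

/-- Translation invariance of the observable of a face list at constant angle. [cite: GlazmanManolescu2019, §4.2] -/
theorem parafermionOn_dom_map_shiftBy (v : ℤ × ℤ) (θ : ℝ) (Dl : List Face) (a z : MidEdge) :
    parafermionOn (PlaquetteWalk.dom (Dl.map (Face.shiftBy v))) (a.shiftBy v) (fun _ => θ) (z.shiftBy v) =
      parafermionOn (PlaquetteWalk.dom Dl) a (fun _ => θ) z := by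
  haveI : Finite (Face.shiftBy (-v) ⁻¹' PlaquetteWalk.dom Dl) := by rw [← dom_map_shiftBy]; infer_instance
  rw [parafermionOn_congr (dom_map_shiftBy v Dl)]
  exact YBWalk.parafermionOn_shiftBy v _ a z θ

/-- ★ **Translation invariance of the vertex functional** (printed weights, any `θ`): translating the face
list, the root and the rhombus together does not change `VF`. [cite: GlazmanManolescu2019, §4.2 (translation invariance)] -/
theorem vertexFunctional_printed_shiftBy (v : ℤ × ℤ) (θ : ℝ) (Dl : List Face) (a : MidEdge) (f : Face) :
    vertexFunctional (printedWeights θ) tFiveEighths (ybCoeff θ) (Dl.map (Face.shiftBy v)) (a.shiftBy v) (Face.shiftBy v f) =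
      vertexFunctional (printedWeights θ) tFiveEighths (ybCoeff θ) Dl a f := by
  rw [vertexFunctional_printed_eq_phase_mul_lem21Defect, vertexFunctional_printed_eq_phase_mul_lem21Defect,
    slantPot_shiftBy, Face.side_shiftBy, Face.side_shiftBy, Face.side_shiftBy, Face.side_shiftBy,
    parafermionOn_dom_map_shiftBy, parafermionOn_dom_map_shiftBy, parafermionOn_dom_map_shiftBy,
    parafermionOn_dom_map_shiftBy]

/-- The origin is the `W` side of `(0, 0)`; the `W` side of `w` is its translate. [folklore] [cite: GlazmanManolescu2019, §4.2 (translation invariance)] -/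
theorem side_W_eq_shiftBy_origin (w : Face) : w.side .W = origin.shiftBy w := by
  obtain ⟨k, j⟩ := w
  simp [Face.side, origin, MidEdge.shiftBy]

/-- ★★★ **THE VERTEX FUNCTIONAL AT `θ = π/3` FROM ANY `W`-ROOT.** For a finite face list `Dl`, a root on the
`W` side of a rhombus `w` whose western neighbour is outside `Dl`, and EVERY rhombus `f`:
`(2ω − 1)·VF_{Dl}(w.side W; f) = Σ (c_{T₁} + c_{T₂})` over Duminil-Copin–Smirnov's mid-edge walks of the
triangle domain of the translated list `Dl − w` (root at the origin), at the two triangles of `f − w`.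
[cite: GlazmanManolescu2019, §1 (θ = π/3), Lemma 2.1, §4.2] [cite: DuminilCopinSmirnov2012, Lemma 1] -/
theorem vertexFunctional_printed_pi_div_three_eq_sum_cv_of_W_root (Dl : List Face) (w : Face)
    (hw : ((w.1 - 1 : ℤ), w.2) ∉ Dl) (f : Face) :
    (2 * omg - 1) * vertexFunctional (printedWeights (π / 3)) tFiveEighths (ybCoeff (π / 3)) Dl (w.side .W) f =
      ∑ P ∈ midWalks (triSet (Dl.map (Face.shiftBy (-w))).toFinset),
        (cv ((Face.shiftBy (-w) f).hv .W) P + cv ((Face.shiftBy (-w) f).hv .E) P) := by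
  have hD : ((-1 : ℤ), (0 : ℤ)) ∉ Dl.map (Face.shiftBy (-w)) := by
    rw [List.mem_map]
    rintro ⟨g, hg, he⟩
    obtain ⟨k, j⟩ := g
    obtain ⟨k₀, j₀⟩ := w
    simp only [Face.shiftBy, Prod.neg_mk, Prod.mk.injEq] at he
    have : ((k, j) : Face) = (k₀ - 1, j₀) := by ext <;> simp <;> omega
    exact hw (this ▸ hg)
  rw [← vertexFunctional_printed_pi_div_three_eq_sum_cv _ hD, ← vertexFunctional_printed_shiftBy (-w) (π / 3) Dl,
    side_W_eq_shiftBy_origin]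
  congr 2
  obtain ⟨k, j⟩ := w
  simp [MidEdge.shiftBy, origin]

/-- ★★ **THE OBSERVABLE IDENTITY FROM ANY `W`-ROOT**: `F_{Dl}(w.side W; z)` at `Θ ≡ π/3` is DCS's observable
of the translated triangle domain at the translated side. [cite: GlazmanManolescu2019, §1 and §4.2] [cite: DuminilCopinSmirnov2012, Definition 1] -/
theorem parafermionOn_pi_div_three_eq_hexObservableAt_of_W_root (Dl : List Face) (w : Face)
    (hw : ((w.1 - 1 : ℤ), w.2) ∉ Dl) (z : MidEdge) :
    parafermionOn (PlaquetteWalk.dom Dl) (w.side .W) (fun _ => π / 3) z =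
      hexObservableAt (triSet (Dl.map (Face.shiftBy (-w))).toFinset) (z.shiftBy (-w)) := by
  have hD : ((-1 : ℤ), (0 : ℤ)) ∉ PlaquetteWalk.dom (Dl.map (Face.shiftBy (-w))) := by
    simp only [PlaquetteWalk.dom, Set.mem_setOf_eq, List.mem_map]
    rintro ⟨g, hg, he⟩
    obtain ⟨k, j⟩ := g
    obtain ⟨k₀, j₀⟩ := w
    simp only [Face.shiftBy, Prod.neg_mk, Prod.mk.injEq] at he
    have : ((k, j) : Face) = (k₀ - 1, j₀) := by ext <;> simp <;> omega
    exact hw (this ▸ hg)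
  have h1 := parafermionOn_pi_div_three_eq_hexObservableAt (PlaquetteWalk.dom (Dl.map (Face.shiftBy (-w))))
    (Dl.map (Face.shiftBy (-w))).toFinset (fun g => by simp [PlaquetteWalk.dom]) hD (z.shiftBy (-w))
  rw [← h1, ← parafermionOn_dom_map_shiftBy (-w) (π / 3) Dl, side_W_eq_shiftBy_origin]
  congr 2
  obtain ⟨k, j⟩ := w
  simp [MidEdge.shiftBy, origin]

/-- ★★ **GM19's (CR) contour form at `θ = π/3` through DCS's observable** (the factor `2ω − 1` cancelled):
`VF_{Dl}(origin; f) = Σ_s crCoef (π/3) s · F_hex(f.side s) = F(z_E) − F(z_W) + e^{iπ/3}(F(z_N) − F(z_S))` with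
`F = hexObservableAt (triSet Dl)`. [cite: GlazmanManolescu2019, Lemma 2.1, eq. (CR)] [cite: DuminilCopinSmirnov2012, Definition 1] -/
theorem vertexFunctional_printed_pi_div_three_eq_sum_crCoef (Dl : List Face) (hD : ((-1 : ℤ), (0 : ℤ)) ∉ Dl)
    (f : Face) :
    vertexFunctional (printedWeights (π / 3)) tFiveEighths (ybCoeff (π / 3)) Dl origin f =
      ∑ s : Side, crCoef (π / 3) s * hexObservableAt (triSet Dl.toFinset) (f.side s) := by
  have h := vertexFunctional_printed_pi_div_three_eq_sum_cv Dl hD f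
  rw [sum_cv_add_cv_eq] at h
  simp only [edir_hv_hvAcross, mul_assoc, ← Finset.mul_sum] at h
  exact mul_left_cancel₀ two_mul_omg_sub_one_ne_zero h

end GeneralRoot


/-! ## §16. The three other root orientations at `θ = π/3`, by the dihedral covariance of the vertex functional
(`PlaquetteWalkMirrorDuality`: half turn `VF ↦ −VF`, diagonal `VF(τ·) = r·conj VF`, anti-diagonal `VF(σ·) = −r·conj VF`)
composed with §14 (edition 11) -/

section Roots

open HV Literature.Barriers.CriticalPhenomena.PlaquetteWalk
open Literature.Barriers.CriticalPhenomena (PlaquetteWalk.dom)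

/-- `conj (2ω − 1) = −(2ω − 1)`: the factor `2ω − 1 = i√3` of §12 is purely imaginary (the tree's `HV.conj_omg_eq`,
`ω̄ = 1 − ω`). [folklore] [cite: DuminilCopinSmirnov2012, Lemma 1] -/
theorem conj_two_mul_omg_sub_one : (starRingEnd ℂ) (2 * omg - 1) = -(2 * omg - 1) := by
  rw [map_sub, map_mul, map_ofNat, map_one, conj_omg_eq]; ring

/-- The half turn through the origin maps the `E` side of `w` to the `W` side of `−w`.
[cite: GlazmanManolescu2019, §1 (the lattice of rhombi and its mid-edges)] -/
theorem halfTurn_side_E (w : Face) :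
    mirrorRow 0 (mirrorCol 0 (w.side .E)) = Face.side ((-w.1 : ℤ), (-w.2 : ℤ)) .W := by
  obtain ⟨k, j⟩ := w
  rw [mirrorCol_side, mirrorRow_side]
  simp [mirrorColFace, mirrorRowFace, mirrorColSide, mirrorSide]

/-- The diagonal reflection maps the `S` side of `w` to the `W` side of `τw = (w.2, w.1)`.
[cite: GlazmanManolescu2019, §1 (the lattice of rhombi and its mid-edges)] -/
theorem mirrorDiag_side_S (w : Face) : mirrorDiag (w.side .S) = Face.side (w.2, w.1) .W := by
  obtain ⟨k, j⟩ := w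
  rw [mirrorDiag_side]
  rfl

/-- The anti-diagonal reflection (half turn, then diagonal) maps the `N` side of `w` to the `W` side of
`(−w.2, −w.1)`. [cite: GlazmanManolescu2019, §1 (the lattice of rhombi and its mid-edges)] -/
theorem antiDiag_side_N (w : Face) :
    mirrorDiag (mirrorRow 0 (mirrorCol 0 (w.side .N))) = Face.side ((-w.2 : ℤ), (-w.1 : ℤ)) .W := by
  obtain ⟨k, j⟩ := w
  rw [mirrorCol_side, mirrorRow_side, mirrorDiag_side]
  simp [mirrorColFace, mirrorRowFace, mirrorColSide, mirrorSide, mirrorDiagFace, mirrorDiagSide]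

/-- ★★ **The dictionary at an `E`-rooted rhombus** (root on the `E` side of `w`, the eastern neighbour `(w.1 + 1, w.2)`
outside the list): `(2ω − 1)·VF_{π/3}(Dl; w.side E; f)` is MINUS the sum of Duminil-Copin–Smirnov's two triangle
relations at the image rhombus in the HALF-TURNED list `−Dl` (re-rooted at `−w`, a `W`-root), by
`vertexFunctional_printed_halfTurn` (the half turn negates the vertex functional at every angle) and §14.
[cite: GlazmanManolescu2019, Lemma 2.1, eq. (2.2) (CR)] [cite: DuminilCopinSmirnov2012, Lemma 1] -/
theorem vertexFunctional_printed_pi_div_three_eq_neg_sum_cv_of_E_root (Dl : List Face) (w : Face)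
    (hw : ((w.1 + 1 : ℤ), w.2) ∉ Dl) (f : Face) :
    (2 * omg - 1) * vertexFunctional (printedWeights (π / 3)) tFiveEighths (ybCoeff (π / 3)) Dl (w.side .E) f =
      -∑ P ∈ midWalks (triSet (((Dl.map (mirrorColFace 0)).map (mirrorRowFace 0)).map
          (Face.shiftBy (-(((-w.1 : ℤ), (-w.2 : ℤ)) : Face)))).toFinset),
        (cv ((Face.shiftBy (-(((-w.1 : ℤ), (-w.2 : ℤ)) : Face)) (mirrorRowFace 0 (mirrorColFace 0 f))).hv .W) P +
          cv ((Face.shiftBy (-(((-w.1 : ℤ), (-w.2 : ℤ)) : Face)) (mirrorRowFace 0 (mirrorColFace 0 f))).hv .E) P) := by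
  have hT := vertexFunctional_printed_halfTurn (π / 3) 0 0 Dl (w.side .E) f
  rw [halfTurn_side_E] at hT
  have hw' : (((((-w.1 : ℤ), (-w.2 : ℤ)) : Face).1 - 1 : ℤ), (((-w.1 : ℤ), (-w.2 : ℤ)) : Face).2) ∉
      (Dl.map (mirrorColFace 0)).map (mirrorRowFace 0) := by
    rw [List.map_map, List.mem_map]
    rintro ⟨g, hg, he⟩
    obtain ⟨k, j⟩ := g
    simp only [Function.comp_apply, mirrorColFace, mirrorRowFace, Prod.mk.injEq] at he
    obtain ⟨h1, h2⟩ := he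
    have hk : k = w.1 + 1 := by omega
    have hj : j = w.2 := by omega
    subst hk; subst hj
    exact hw hg
  have hW := vertexFunctional_printed_pi_div_three_eq_sum_cv_of_W_root
    ((Dl.map (mirrorColFace 0)).map (mirrorRowFace 0)) ((-w.1 : ℤ), (-w.2 : ℤ)) hw'
    (mirrorRowFace 0 (mirrorColFace 0 f))
  rw [hT, mul_neg] at hW
  rw [← hW, neg_neg]

/-- ★★ **The dictionary at an `S`-rooted rhombus** (root on the `S` side of `w`, the southern neighbour `(w.1, w.2 − 1)`
outside the list): `(2ω − 1)·VF_{π/3}(Dl; w.side S; f) = −r(π/3) · conj` of the sum of the two triangle relations at the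
image rhombus in the TRANSPOSED list `τDl` (re-rooted at `τw = (w.2, w.1)`, a `W`-root), by
`vertexFunctional_printed_map_mirrorDiag` (`VF_θ(τ·) = r(θ)·conj VF_θ(·)`), `conj (2ω − 1) = −(2ω − 1)` and §14.
[cite: GlazmanManolescu2019, Lemma 2.1, eq. (2.2) (CR)] [cite: DuminilCopinSmirnov2012, Lemma 1] -/
theorem vertexFunctional_printed_pi_div_three_eq_conj_sum_cv_of_S_root (Dl : List Face) (w : Face)
    (hw : (w.1, (w.2 - 1 : ℤ)) ∉ Dl) (f : Face) :
    (2 * omg - 1) * vertexFunctional (printedWeights (π / 3)) tFiveEighths (ybCoeff (π / 3)) Dl (w.side .S) f =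
      -(ybRatio (π / 3) * (starRingEnd ℂ)
        (∑ P ∈ midWalks (triSet ((Dl.map mirrorDiagFace).map (Face.shiftBy (-((w.2, w.1) : Face)))).toFinset),
          (cv ((Face.shiftBy (-((w.2, w.1) : Face)) (mirrorDiagFace f)).hv .W) P +
            cv ((Face.shiftBy (-((w.2, w.1) : Face)) (mirrorDiagFace f)).hv .E) P))) := by
  have hT := vertexFunctional_printed_map_mirrorDiag (π / 3) Dl (w.side .S) f
  rw [mirrorDiag_side_S] at hT
  have hw' : ((((w.2, w.1) : Face).1 - 1 : ℤ), ((w.2, w.1) : Face).2) ∉ Dl.map mirrorDiagFace := by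
    rw [List.mem_map]
    rintro ⟨g, hg, he⟩
    obtain ⟨k, j⟩ := g
    simp only [mirrorDiagFace, Prod.mk.injEq] at he
    obtain ⟨h1, h2⟩ := he
    subst h2
    have hj : j = w.2 - 1 := by omega
    subst hj
    exact hw hg
  have hW := vertexFunctional_printed_pi_div_three_eq_sum_cv_of_W_root (Dl.map mirrorDiagFace) (w.2, w.1) hw'
    (mirrorDiagFace f)
  rw [hT] at hW
  -- hW : (2ω−1) * (r * conj VF) = Σ ; conjugate it
  have hc := congrArg (starRingEnd ℂ) hW
  rw [map_mul, map_mul, Complex.conj_conj, conj_two_mul_omg_sub_one] at hc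
  have hr : (starRingEnd ℂ) (ybRatio (π / 3)) * ybRatio (π / 3) = 1 := conj_ybRatio_mul_ybRatio (π / 3)
  set V := vertexFunctional (printedWeights (π / 3)) tFiveEighths (ybCoeff (π / 3)) Dl (w.side .S) f
  set S' := ∑ P ∈ midWalks (triSet ((Dl.map mirrorDiagFace).map (Face.shiftBy (-((w.2, w.1) : Face)))).toFinset),
      (cv ((Face.shiftBy (-((w.2, w.1) : Face)) (mirrorDiagFace f)).hv .W) P +
        cv ((Face.shiftBy (-((w.2, w.1) : Face)) (mirrorDiagFace f)).hv .E) P)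
  -- hc : -(2ω−1) * (conj r * V) = conj S'
  linear_combination (-(ybRatio (π / 3))) * hc - (2 * omg - 1) * V * hr

/-- ★★ **The dictionary at an `N`-rooted rhombus** (root on the `N` side of `w`, the northern neighbour `(w.1, w.2 + 1)`
outside the list): `(2ω − 1)·VF_{π/3}(Dl; w.side N; f) = +r(π/3) · conj` of the sum of the two triangle relations at the
image rhombus in the ANTI-TRANSPOSED list `σDl` (`σ(x, y) = (−y, −x)`, re-rooted at `σw`, a `W`-root), by
`vertexFunctional_printed_antiDiag` (`VF_θ(σ·) = −r(θ)·conj VF_θ(·)`), `conj (2ω − 1) = −(2ω − 1)` and §14.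
[cite: GlazmanManolescu2019, Lemma 2.1, eq. (2.2) (CR)] [cite: DuminilCopinSmirnov2012, Lemma 1] -/
theorem vertexFunctional_printed_pi_div_three_eq_conj_sum_cv_of_N_root (Dl : List Face) (w : Face)
    (hw : (w.1, (w.2 + 1 : ℤ)) ∉ Dl) (f : Face) :
    (2 * omg - 1) * vertexFunctional (printedWeights (π / 3)) tFiveEighths (ybCoeff (π / 3)) Dl (w.side .N) f =
      ybRatio (π / 3) * (starRingEnd ℂ)
        (∑ P ∈ midWalks (triSet ((((Dl.map (mirrorColFace 0)).map (mirrorRowFace 0)).map mirrorDiagFace).map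
            (Face.shiftBy (-(((-w.2 : ℤ), (-w.1 : ℤ)) : Face)))).toFinset),
          (cv ((Face.shiftBy (-(((-w.2 : ℤ), (-w.1 : ℤ)) : Face))
              (mirrorDiagFace (mirrorRowFace 0 (mirrorColFace 0 f)))).hv .W) P +
            cv ((Face.shiftBy (-(((-w.2 : ℤ), (-w.1 : ℤ)) : Face))
              (mirrorDiagFace (mirrorRowFace 0 (mirrorColFace 0 f)))).hv .E) P)) := by
  have hT := vertexFunctional_printed_antiDiag (π / 3) 0 0 Dl (w.side .N) f
  rw [antiDiag_side_N] at hT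
  have hw' : (((((-w.2 : ℤ), (-w.1 : ℤ)) : Face).1 - 1 : ℤ), (((-w.2 : ℤ), (-w.1 : ℤ)) : Face).2) ∉
      ((Dl.map (mirrorColFace 0)).map (mirrorRowFace 0)).map mirrorDiagFace := by
    rw [List.map_map, List.map_map, List.mem_map]
    rintro ⟨g, hg, he⟩
    obtain ⟨k, j⟩ := g
    simp only [Function.comp_apply, mirrorColFace, mirrorRowFace, mirrorDiagFace, Prod.mk.injEq] at he
    obtain ⟨h1, h2⟩ := he
    have hk : k = w.1 := by omega
    have hj : j = w.2 + 1 := by omega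
    subst hk; subst hj
    exact hw hg
  have hW := vertexFunctional_printed_pi_div_three_eq_sum_cv_of_W_root
    (((Dl.map (mirrorColFace 0)).map (mirrorRowFace 0)).map mirrorDiagFace) ((-w.2 : ℤ), (-w.1 : ℤ)) hw'
    (mirrorDiagFace (mirrorRowFace 0 (mirrorColFace 0 f)))
  rw [hT] at hW
  have hc := congrArg (starRingEnd ℂ) hW
  rw [map_mul, map_neg, map_mul, Complex.conj_conj, conj_two_mul_omg_sub_one] at hc
  have hr : (starRingEnd ℂ) (ybRatio (π / 3)) * ybRatio (π / 3) = 1 := conj_ybRatio_mul_ybRatio (π / 3)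
  set V := vertexFunctional (printedWeights (π / 3)) tFiveEighths (ybCoeff (π / 3)) Dl (w.side .N) f
  -- hc : -(2ω−1) * -(conj r * V) = conj Σ ; goal (2ω−1) V = r conj Σ
  linear_combination (ybRatio (π / 3)) * hc - (2 * omg - 1) * V * hr

end Roots


/-! ## §15. The hole-root defect of the Yang–Baxter relation at `θ = π/3` is carried by the encircling
honeycomb loops (edition 5; composition with `HexSAWVertexRelationHoleRoot`) -/

section HoleRootDefect

open HV Literature.Barriers.CriticalPhenomena.PlaquetteWalk
open Literature.Barriers.CriticalPhenomena (PlaquetteWalk.dom)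

/-- ★★★ **THE YANG–BAXTER DEFECT AT `θ = π/3` = THE ENCIRCLING HONEYCOMB LOOPS.** For a finite face list `Dl`
rooted on the `W` side of a rhombus `w` (western neighbour outside), at EVERY rhombus `f ∈ Dl` (translated
triangles `T₁ = (f−w).hv W`, `T₂ = (f−w).hv E` in the triangle domain `V` of `Dl − w`):
`(2ω − 1)·VF_{Dl}(w.side W; f) = Σ_{γ ∈ loop class at T₁, loop winds about the root face} (dir)·x_c^ℓ λ^{pturn}
 + (same at T₂)` — Duminil-Copin–Smirnov's triplets and non-encircling pairs cancel inside each triangle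
relation (`HexSAWVertexRelationHoleRoot.sum_cv_eq_sum_encircling`), and the rhombus relation is the sum of the
two triangle relations (`vertexFunctional_printed_pi_div_three_eq_sum_cv_of_W_root`). For an outer root no loop
of `V` winds about the root face and the right-hand side is `0` (GM19 Lemma 2.1 / C-B2); for a hole root this
is the explicit walk expansion of the defect. [cite: GlazmanManolescu2019, §1 (θ = π/3), Lemma 2.1] [cite: DuminilCopinSmirnov2012, Lemma 1 and its proof («we used the fact that a is on the boundary and Ω is simply connected»)] -/
theorem vertexFunctional_printed_pi_div_three_eq_sum_encircling (Dl : List Face) (w : Face)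
    (hw : ((w.1 - 1 : ℤ), w.2) ∉ Dl) {f : Face} (hf : f ∈ Dl) :
    (2 * omg - 1) * vertexFunctional (printedWeights (π / 3)) tFiveEighths (ybCoeff (π / 3)) Dl (w.side .W) f =
      (∑ P ∈ (clsLoop (triSet (Dl.map (Face.shiftBy (-w))).toFinset) ((Face.shiftBy (-w) f).hv .W)).filter
          (fun P => loopWnd ((Face.shiftBy (-w) f).hv .W) P ≠ 0),
        edir ((Face.shiftBy (-w) f).hv .W) (finalDart P).1 * pwt P) +
      (∑ P ∈ (clsLoop (triSet (Dl.map (Face.shiftBy (-w))).toFinset) ((Face.shiftBy (-w) f).hv .E)).filter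
          (fun P => loopWnd ((Face.shiftBy (-w) f).hv .E) P ≠ 0),
        edir ((Face.shiftBy (-w) f).hv .E) (finalDart P).1 * pwt P) := by
  have hD : ((-1 : ℤ), (0 : ℤ)) ∉ (Dl.map (Face.shiftBy (-w))).toFinset := by
    rw [List.mem_toFinset, List.mem_map]
    rintro ⟨g, hg, he⟩
    obtain ⟨k, j⟩ := g
    obtain ⟨k₀, j₀⟩ := w
    simp only [Face.shiftBy, Prod.neg_mk, Prod.mk.injEq] at he
    have : ((k, j) : Face) = (k₀ - 1, j₀) := by ext <;> simp <;> omega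
    exact hw (this ▸ hg)
  have hwOut : wOut ∉ triSet (Dl.map (Face.shiftBy (-w))).toFinset := wOut_not_mem_triSet hD
  have hfm : Face.shiftBy (-w) f ∈ (Dl.map (Face.shiftBy (-w))).toFinset :=
    List.mem_toFinset.2 (List.mem_map.2 ⟨f, hf, rfl⟩)
  rw [vertexFunctional_printed_pi_div_three_eq_sum_cv_of_W_root Dl w hw f, Finset.sum_add_distrib,
    sum_cv_eq_sum_encircling hwOut (hv_mem_triSet hfm .W), sum_cv_eq_sum_encircling hwOut (hv_mem_triSet hfm .E)]

/-- ★★ **Corollary: if no honeycomb loop through the two triangles of `f` winds about the root face, the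
Yang–Baxter relation holds at `f` at `θ = π/3`** — in particular at every rhombus for an outer root, and at the
rhombi of a hole-rooted domain that no encircling loop can pass (the θ = π/3 endpoint zeros of the lane's
tables). [cite: GlazmanManolescu2019, Lemma 2.1] [cite: DuminilCopinSmirnov2012, Lemma 1] -/
theorem vertexFunctional_printed_pi_div_three_eq_zero_of_loopWnd (Dl : List Face) (w : Face)
    (hw : ((w.1 - 1 : ℤ), w.2) ∉ Dl) {f : Face} (hf : f ∈ Dl)
    (h₁ : ∀ P ∈ clsLoop (triSet (Dl.map (Face.shiftBy (-w))).toFinset) ((Face.shiftBy (-w) f).hv .W),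
      loopWnd ((Face.shiftBy (-w) f).hv .W) P = 0)
    (h₂ : ∀ P ∈ clsLoop (triSet (Dl.map (Face.shiftBy (-w))).toFinset) ((Face.shiftBy (-w) f).hv .E),
      loopWnd ((Face.shiftBy (-w) f).hv .E) P = 0) :
    vertexFunctional (printedWeights (π / 3)) tFiveEighths (ybCoeff (π / 3)) Dl (w.side .W) f = 0 := by
  have h := vertexFunctional_printed_pi_div_three_eq_sum_encircling Dl w hw hf
  rw [Finset.sum_eq_zero (fun P hP => ?_), Finset.sum_eq_zero (fun P hP => ?_), add_zero] at h
  · exact (mul_eq_zero.1 h).resolve_left two_mul_omg_sub_one_ne_zero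
  · obtain ⟨hP, hz⟩ := Finset.mem_filter.1 hP; exact absurd (h₂ P hP) hz
  · obtain ⟨hP, hz⟩ := Finset.mem_filter.1 hP; exact absurd (h₁ P hP) hz

end HoleRootDefect


/-! ## §17. The boundary flux of the observable at `θ = π/3` is the TOTAL encircling weight (composition of §15 with the
lane's discrete Stokes identity `PlaquetteWalkContourSum.sum_vertexFunctional_printed_eq_boundarySum`; edition 13) -/

section BoundaryFlux

open HV Literature.Barriers.CriticalPhenomena.PlaquetteWalk
open Literature.Barriers.CriticalPhenomena (PlaquetteWalk.dom)

/-- ★★ **TOTAL ENCIRCLING WEIGHT = BOUNDARY FLUX, at `θ = π/3`.** For every finite face list `Dl` rooted on the `W` side of a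
rhombus `w` (western neighbour outside), `(2ω − 1)` times the BOUNDARY SUM of Glazman–Manolescu's observable (the lane's
`boundarySum`: the (CR)-weighted values on all boundary mid-edges, outer boundary and hole boundaries, root term included)
equals the sum over ALL rhombi `f ∈ Dl` of the signed weights of the honeycomb loop-class walks through the two
triangles of `f` that wind about the root face. Discrete Stokes (`sum_vertexFunctional_printed_eq_boundarySum`: the
vertex functionals of all faces add up to the boundary sum — the interior mid-edges cancel) composed with §15 face by
face. For an outer root no loop winds and the boundary sum vanishes (GM19 Lemma 2.2 / the tree's
`boundarySum_printed_eq_zero_of_outerRoot`); for a hole root this says WHERE the contour identity's defect lives.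
[cite: GlazmanManolescu2019, Lemma 2.2 (stated from [Gl, Lem. 4.1])] [cite: DuminilCopinSmirnov2012, proof of Lemma 2 («Values at interior mid-edges disappear»)] -/
theorem boundarySum_printed_pi_div_three_eq_sum_encircling (Dl : List Face) (w : Face)
    (hw : ((w.1 - 1 : ℤ), w.2) ∉ Dl) :
    (2 * omg - 1) * boundarySum (printedWeights (π / 3)) tFiveEighths (ybCoeff (π / 3)) Dl (w.side .W) =
      ∑ f ∈ Dl.toFinset,
        ((∑ P ∈ (clsLoop (triSet (Dl.map (Face.shiftBy (-w))).toFinset) ((Face.shiftBy (-w) f).hv .W)).filter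
            (fun P => loopWnd ((Face.shiftBy (-w) f).hv .W) P ≠ 0),
          edir ((Face.shiftBy (-w) f).hv .W) (finalDart P).1 * pwt P) +
        (∑ P ∈ (clsLoop (triSet (Dl.map (Face.shiftBy (-w))).toFinset) ((Face.shiftBy (-w) f).hv .E)).filter
            (fun P => loopWnd ((Face.shiftBy (-w) f).hv .E) P ≠ 0),
          edir ((Face.shiftBy (-w) f).hv .E) (finalDart P).1 * pwt P)) := by
  rw [← sum_vertexFunctional_printed_eq_boundarySum, Finset.mul_sum]
  refine Finset.sum_congr rfl fun f hf => ?_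
  exact vertexFunctional_printed_pi_div_three_eq_sum_encircling Dl w hw (List.mem_toFinset.1 hf)

end BoundaryFlux


/-! ## §18. Cross-check with the lane's HONEYCOMB FAR-CELL LAW at the far cell of a `W`-rooted hole: the two closed
forms of the defect agree (composition with `PlaquetteWalkHoleRootFarCellLaw`; edition 14) -/

section FarCell

open HV Literature.Barriers.CriticalPhenomena.PlaquetteWalk
open Literature.Barriers.CriticalPhenomena (PlaquetteWalk.dom)
open Literature.Probability.RandomPlanarGeometry.SAW (hexCriticalFugacity)

/-- ★★ **Two walk expansions of one defect agree.** At the FAR CELL `farW w = (w.1 − 2, w.2)` of a `W`-rooted hole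
(`holeFaceW w = (w.1 − 1, w.2) ∉ Dl`, `farW w ∈ Dl`, root not interior), the signed weight of Duminil-Copin–Smirnov's
honeycomb loop-class walks through the two triangles of the far cell that wind about the hole (§15) equals
`(2ω − 1)·i·x_c²·(Σ_over x_c^ℓ − Σ_under x_c^ℓ)`, the lane's honeycomb far-cell law
(`vertexFunctional_printed_farCellW_pi_div_three_eq`: sums over the `w₂`-free WOUND class-`B2a` Yang–Baxter walks at the
far cell entering it over resp. under the hole) — both being `(2ω − 1)·VF_{π/3}` at the far cell. An identity between
two differently organised families of self-avoiding honeycomb walks, obtained by equating two theorems.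
[cite: GlazmanManolescu2019, §4 (opening of §4: SAW on H(π/3) is the hexagonal-lattice walk), Lemma 2.1]
[cite: DuminilCopinSmirnov2012, Lemma 1] -/
theorem sum_encircling_farW_eq_routeMass (Dl : List Face) (w : Face) (hf : farW w ∈ Dl)
    (hh : holeFaceW w ∉ PlaquetteWalk.dom Dl) (hr : RootedFace (PlaquetteWalk.dom Dl) (w.side .W) (farW w)) :
    (∑ P ∈ (clsLoop (triSet (Dl.map (Face.shiftBy (-w))).toFinset) ((Face.shiftBy (-w) (farW w)).hv .W)).filter
          (fun P => loopWnd ((Face.shiftBy (-w) (farW w)).hv .W) P ≠ 0),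
        edir ((Face.shiftBy (-w) (farW w)).hv .W) (finalDart P).1 * pwt P) +
      (∑ P ∈ (clsLoop (triSet (Dl.map (Face.shiftBy (-w))).toFinset) ((Face.shiftBy (-w) (farW w)).hv .E)).filter
          (fun P => loopWnd ((Face.shiftBy (-w) (farW w)).hv .E) P ≠ 0),
        edir ((Face.shiftBy (-w) (farW w)).hv .E) (finalDart P).1 * pwt P) =
      (2 * omg - 1) * (Complex.I * ((hexCriticalFugacity ^ 2 : ℝ) : ℂ) *
        (((∑ ω ∈ ΩG.setB2a (PlaquetteWalk.dom Dl) (w.side .W) (farW w), ΩG.hexRouteMassW hr .N ω) -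
          ∑ ω ∈ ΩG.setB2a (PlaquetteWalk.dom Dl) (w.side .W) (farW w), ΩG.hexRouteMassW hr .S ω : ℝ) : ℂ)) := by
  have hw : ((w.1 - 1 : ℤ), w.2) ∉ Dl := by
    simpa only [holeFaceW, PlaquetteWalk.dom, Set.mem_setOf_eq] using hh
  rw [← vertexFunctional_printed_pi_div_three_eq_sum_encircling Dl w hw hf,
    vertexFunctional_printed_farCellW_pi_div_three_eq Dl w hf hh hr]

end FarCell

end Literature.Probability.RandomPlanarGeometry.SAW.YangBaxter
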